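import Literature.Topology.FourManifolds.DehnNielsenBaerMeridianAction
import HarnessLib

/-!
# Dehn–Nielsen–Baer on the flower surface: the lower hole circle of the standard sector

Topic `Literature/Topology/FourManifolds`; PROOF file of the named fact
`Literature.Topology.FourManifolds.DehnNielsenBaerSurfaceSmooth` (`DehnNielsenBaerSurface.lean`), geometric half of
item W2.3-hole (the action of the Dehn twist about a hole circle on the melon marking; sequel of
`DehnNielsenBaerMeridianOrbit.lean`/`DehnNielsenBaerMeridianAction.lean`).  The twist is taken
about the **lower hole circle** `K(s) = {q_g ∘ π = s} × {z = -√(c_g - s)}` of the standard sector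
(`s` slightly below `c_g`), so that the access path `γ` (`z ≥ 0`) and the lens loop `ℓ_b` (`z = 0`)
are untouched and only the head of the `C₁`-loop `ℓ_a` (the lower `C₁` edge leaving `P`) is
twisted.  Here:

* §1 the level-`s` floor angle `θ_s(r) = g⁻¹ arccos(min 1 ((s - r²)/V(r)))` (`θ_c = θ_lo`) and the
  two arcs `Kup s r`, `Kdn s r` (lower sheet, `y ≥ 0` / `y ≤ 0`) of the hole circle;
* §2 the radii `rIn s < r_a < rOut s` where `prof = s` (`prof ≥ s` exactly on `[rIn s, rOut s]`
  within `[0, r_b]`);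
* §3 the open standard sector `osec` of the plane, its frontier (valley rays) and the
  **confinement of level-preserving curves**: a curve of level `s > prof(r_b)` starting in
  `osec ∩ {r < r_b}` stays there (it can neither reach the circle `r = r_b`, where `q_g ≤ prof(r_b)`,
  nor a valley ray, where `q_g = vprof < s`); hence it lies in no other slice;
* §4 the hole circle `holeC s` as a set, `= Kup s '' [rIn, rOut] ∪ Kdn s '' [rIn, rOut]`, connected,
  closed;
* §5 for an `H = (q_g ∘ π, z)`-preserving flow of the twist field with a closed orbit through a
  point of `holeC s`: orbit `= holeC s` (flow chart + connectedness), the minimal period, and the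
  simple periodic parametrisation from the outer axis point `A⁻ = Cdn(rOut s)` (`exists_holeOrbit`);
* §6 the END MAP on lower-sheet points over polar points (`Cdn r`, `Lup r`/`Ldn r`, `I`) and on the
  arcs `Kup`, `Kdn`;
* §7 the standard parametrisation `Kloop` of `holeC s` and the standard loop `stdLoop` at `A⁻`;
  **reading**: every loop at `A⁻` in the sector parametrised once round `holeC s` has the class of
  `stdLoop` or of its inverse (`cl_eq_or_of_isParamOn_hole`, via the two runs `y ≤ 0`, `y ≥ 0`);
* §8 the conjugate `holeLoopP = a₀ · stdLoop · a₀⁻¹` by the `C₁`-edge `a₀` from `P` to `A⁻` reads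
  the lens loop: `cl holeLoopP = cl ℓ_b` (`cl_holeLoopP`, through the end-map retraction formula).

Everything is proved; the only definitions are explicit functions/sets (`thloS`, `Kup`, `Kdn`,
`rIn`, `rOut`, `osec`, `holeC`); no named facts (D-0026).

## References

* B. Farb, D. Margalit, *A primer on mapping class groups*, PMS 49 (2012), §3.1.1, Prop. 3.2,
  Thm. 4.1, Thm. 8.1. [FarbMargalit2012]
* H. Zieschang, E. Vogt, H.-D. Coldewey, *Surfaces and planar discontinuous groups*, LNM 835 (1980),
  §3.2, Thm. 5.6.1. [ZieschangVogtColdewey1980]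
* A. Hatcher, *Algebraic Topology* (2002), Prop. 1.17, Example 1.22. [HatcherAT2002]
* J. M. Lee, *Introduction to Smooth Manifolds*, 2nd ed. (2013), Thm. 9.22. [LeeSmoothManifolds2013]
-/

open scoped Manifold ContDiff Topology Real unitInterval
open Set Function Filter Metric

noncomputable section

namespace Literature.Topology.FourManifolds

open PlanarThickening PlanarDouble Literature.Geometry.Manifold Literature.AlgebraicTopology.FundamentalGroup
  Literature.AlgebraicTopology.FundamentalGroup.EdgePath PlanarLevelTwist

/-- Local notation: `𝔼 n` is the model Euclidean space `EuclideanSpace ℝ (Fin n)`. -/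
local notation "𝔼 " n:arg => EuclideanSpace ℝ (Fin n)

namespace FlowerModel

variable {g : ℕ}

/-! ### §1 The level-`s` floor angle and the arcs of the hole circle -/

variable (g) in
/-- **The level-`s` floor angle** `θ_s(r) = g⁻¹ arccos(min 1 ((s - r²)/V(r)))`: for
`vprof(r) ≤ s ≤ prof(r)` the circle of radius `r` meets the level curve `{q_g = s}` of the standard
wedge at the angles `±θ_s(r)`; `θ_{c_g} = θ_lo`. [folklore] -/
def thloS (s r : ℝ) : ℝ := Real.arccos (min 1 ((s - r ^ 2) / V g r)) / g

/-- `0 ≤ θ_s`. [folklore] -/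
theorem thloS_nonneg (s r : ℝ) : 0 ≤ thloS g s r :=
  div_nonneg (Real.arccos_nonneg _) (Nat.cast_nonneg _)

/-- `θ_s ≤ π/g` (`g ≥ 1`). [folklore] -/
theorem thloS_le (hg : 1 ≤ g) (s r : ℝ) : thloS g s r ≤ π / g :=
  div_le_div_of_nonneg_right (Real.arccos_le_pi _) (by exact_mod_cast (show 0 ≤ g by omega))

/-- `θ_c = θ_lo` (`r > 0`). [folklore] -/
theorem thloS_level (hg : 2 ≤ g) {r : ℝ} (hr : 0 < r) : thloS g (level g) r = thlo g r := by
  rw [thloS, thlo_eq hg hr, kap]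

/-- **On `[vprof ≤ s ≤ prof]` the floor angle solves `cos(g θ_s) = (s - r²)/V`.** [folklore] -/
theorem cos_mul_thloS (hg : 1 ≤ g) {s r : ℝ} (hr : 0 < r) (h1 : vprof g r ≤ s) (h2 : s ≤ prof g r) :
    Real.cos (g * thloS g s r) = (s - r ^ 2) / V g r := by
  have hV := V_pos hg hr
  have hg' : (g : ℝ) ≠ 0 := by exact_mod_cast (show g ≠ 0 by omega)
  have hx1 : (s - r ^ 2) / V g r ≤ 1 := by rw [div_le_one hV, prof_eq] at *; linarith
  have hx2 : -1 ≤ (s - r ^ 2) / V g r := by rw [le_div_iff₀ hV]; rw [vprof] at h1; linarith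
  rw [thloS, min_eq_right hx1, mul_div_cancel₀ _ hg', Real.cos_arccos hx2 hx1]

/-- **The two arcs solve `q_g = s`**: `q_g(pol r (±θ_s r)) = s` for `vprof(r) ≤ s ≤ prof(r)`. [folklore] -/
theorem flower_pol_thloS (hg : 1 ≤ g) {s r : ℝ} (hr : 0 < r) (h1 : vprof g r ≤ s) (h2 : s ≤ prof g r) :
    flower g (pol r (thloS g s r)) = s := by
  rw [flower_pol, cos_mul_thloS hg hr h1 h2, mul_div_cancel₀ _ (V_pos hg hr).ne']
  ring

/-- The same for the negative angle. [folklore] -/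
theorem flower_pol_neg_thloS (hg : 1 ≤ g) {s r : ℝ} (hr : 0 < r) (h1 : vprof g r ≤ s) (h2 : s ≤ prof g r) :
    flower g (pol r (-thloS g s r)) = s := by
  rw [flower_pol_neg, flower_pol_thloS hg hr h1 h2]

/-- **Where the circle of radius `r` is inside the level**: `θ_s(r) = 0` when `prof(r) ≤ s`. [folklore] -/
theorem thloS_eq_zero_of_prof_le (hg : 1 ≤ g) {s r : ℝ} (hr : 0 < r) (h : prof g r ≤ s) : thloS g s r = 0 := by
  have hV := V_pos hg hr
  have hx1 : 1 ≤ (s - r ^ 2) / V g r := by rw [le_div_iff₀ hV, prof_eq] at *; linarith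
  rw [thloS, min_eq_left hx1, Real.arccos_one, zero_div]

/-- **The arcs stay off the valley rays**: `θ_s(r) < π/g` when `vprof(r) < s`. [folklore] -/
theorem thloS_lt (hg : 1 ≤ g) {s r : ℝ} (hr : 0 < r) (h : vprof g r < s) : thloS g s r < π / g := by
  have hV := V_pos hg hr
  have hg' : (0 : ℝ) < g := by exact_mod_cast (show 0 < g by omega)
  have hx : -1 < min 1 ((s - r ^ 2) / V g r) := by
    refine lt_min (by norm_num) ?_
    rw [lt_div_iff₀ hV]; rw [vprof] at h; linarith
  rw [thloS, div_lt_div_iff_of_pos_right hg']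
  refine lt_of_le_of_ne (Real.arccos_le_pi _) fun h' => ?_
  rw [Real.arccos_eq_pi] at h'
  linarith

/-- **Continuity of the floor angle in the radius** on `(0, ∞)`. [folklore] -/
theorem continuousOn_thloS (hg : 1 ≤ g) (s : ℝ) : ContinuousOn (thloS g s) (Ioi 0) := by
  have hk : ContinuousOn (fun r => (s - r ^ 2) / V g r) (Ioi 0) :=
    (continuousOn_const.sub (continuousOn_id.pow 2)).div (continuous_V hg).continuousOn
      fun r hr => (V_pos hg hr).ne'
  exact (Real.continuous_arccos.comp_continuousOn (continuous_min.comp_continuousOn (continuousOn_const.prodMk hk))).div_const _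

variable (g) in
/-- **The `y ≥ 0` arc of the lower hole circle at level `s`**: `r ↦ (pol r (θ_s r), -√(c - q))`.
[folklore] -/
def Kup (s r : ℝ) : 𝔼 3 := lowerPt (flower g) (level g) (pol r (thloS g s r))

variable (g) in
/-- **The `y ≤ 0` arc of the lower hole circle at level `s`**: `r ↦ (pol r (-θ_s r), -√(c - q))`.
[folklore] -/
def Kdn (s r : ℝ) : 𝔼 3 := lowerPt (flower g) (level g) (pol r (-thloS g s r))

/-- `Kup`, projected. [folklore] -/
@[simp] theorem proj_Kup (s r : ℝ) : proj (Kup g s r) = pol r (thloS g s r) := by rw [Kup, proj_lowerPt]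

/-- `Kdn`, projected. [folklore] -/
@[simp] theorem proj_Kdn (s r : ℝ) : proj (Kdn g s r) = pol r (-thloS g s r) := by rw [Kdn, proj_lowerPt]

/-- The arcs are continuous in the radius on `(0, ∞)`. [folklore] -/
theorem continuousOn_Kup (hg : 1 ≤ g) (s : ℝ) : ContinuousOn (Kup g s) (Ioi 0) := by
  have h : ContinuousOn (fun r => pol r (thloS g s r)) (Ioi 0) := by
    have e : (fun r => pol r (thloS g s r)) = (fun x : ℝ × ℝ => pol x.1 x.2) ∘ fun r => (r, thloS g s r) := rfl
    rw [e]
    exact continuous_pol.comp_continuousOn (continuousOn_id.prodMk (continuousOn_thloS hg s))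
  have e' : Kup g s = lowerPt (flower g) (level g) ∘ fun r => pol r (thloS g s r) := rfl
  rw [e']
  exact (continuous_lowerPt contDiff_flower.continuous).comp_continuousOn h

/-- The arcs are continuous in the radius on `(0, ∞)`. [folklore] -/
theorem continuousOn_Kdn (hg : 1 ≤ g) (s : ℝ) : ContinuousOn (Kdn g s) (Ioi 0) := by
  have h : ContinuousOn (fun r => pol r (-thloS g s r)) (Ioi 0) := by
    have e : (fun r => pol r (-thloS g s r)) = (fun x : ℝ × ℝ => pol x.1 x.2) ∘ fun r => (r, -thloS g s r) := rfl
    rw [e]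
    exact continuous_pol.comp_continuousOn (continuousOn_id.prodMk (continuousOn_thloS hg s).neg)
  have e' : Kdn g s = lowerPt (flower g) (level g) ∘ fun r => pol r (-thloS g s r) := rfl
  rw [e']
  exact (continuous_lowerPt contDiff_flower.continuous).comp_continuousOn h

/-- On the axis the two arcs meet: `θ_s(r) = 0 → Kup s r = Kdn s r = Cdn r`. [folklore] -/
theorem Kup_eq_Cdn_of {s r : ℝ} (h : thloS g s r = 0) : Kup g s r = Cdn g r := by
  rw [Kup, h, pol_zero_right]; rfl

/-- On the axis the two arcs meet. [folklore] -/
theorem Kdn_eq_Cdn_of {s r : ℝ} (h : thloS g s r = 0) : Kdn g s r = Cdn g r := by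
  rw [Kdn, h, neg_zero, pol_zero_right]; rfl

/-- The `y`-coordinate of the arcs: `(Kup s r)_y = r sin θ_s(r) ≥ 0` (`r ≥ 0`). [folklore] -/
theorem Kup_apply_one (s r : ℝ) : Kup g s r 1 = r * Real.sin (thloS g s r) := by
  rw [Kup, lowerPt]; simp [pol_apply_one]

/-- The `y`-coordinate of the arcs: `(Kdn s r)_y = -r sin θ_s(r) ≤ 0` (`r ≥ 0`). [folklore] -/
theorem Kdn_apply_one (s r : ℝ) : Kdn g s r 1 = -(r * Real.sin (thloS g s r)) := by
  rw [Kdn, lowerPt]; simp [pol_apply_one, Real.sin_neg]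

/-- `sin θ_s ≥ 0`. [folklore] -/
theorem sin_thloS_nonneg (hg : 1 ≤ g) (s r : ℝ) : 0 ≤ Real.sin (thloS g s r) :=
  Real.sin_nonneg_of_nonneg_of_le_pi (thloS_nonneg s r)
    ((thloS_le hg s r).trans (div_le_self Real.pi_pos.le (by exact_mod_cast hg)))

/-- `(Kup s r)_y ≥ 0` for `r ≥ 0`. [folklore] -/
theorem Kup_apply_one_nonneg (hg : 1 ≤ g) (s : ℝ) {r : ℝ} (hr : 0 ≤ r) : 0 ≤ Kup g s r 1 := by
  rw [Kup_apply_one]; exact mul_nonneg hr (sin_thloS_nonneg hg s r)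

/-- `(Kdn s r)_y ≤ 0` for `r ≥ 0`. [folklore] -/
theorem Kdn_apply_one_nonpos (hg : 1 ≤ g) (s : ℝ) {r : ℝ} (hr : 0 ≤ r) : Kdn g s r 1 ≤ 0 := by
  rw [Kdn_apply_one, neg_nonpos]; exact mul_nonneg hr (sin_thloS_nonneg hg s r)

/-- The level of the arcs (`vprof r ≤ s ≤ prof r`). [folklore] -/
theorem flower_proj_Kup (hg : 1 ≤ g) {s r : ℝ} (hr : 0 < r) (h1 : vprof g r ≤ s) (h2 : s ≤ prof g r) :
    flower g (proj (Kup g s r)) = s := by rw [proj_Kup, flower_pol_thloS hg hr h1 h2]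

/-- The level of the arcs (`vprof r ≤ s ≤ prof r`). [folklore] -/
theorem flower_proj_Kdn (hg : 1 ≤ g) {s r : ℝ} (hr : 0 < r) (h1 : vprof g r ≤ s) (h2 : s ≤ prof g r) :
    flower g (proj (Kdn g s r)) = s := by rw [proj_Kdn, flower_pol_neg_thloS hg hr h1 h2]

/-- The height of the arcs: `z = -√(c - s)` (`vprof r ≤ s ≤ prof r`). [folklore] -/
theorem Kup_apply_two (hg : 1 ≤ g) {s r : ℝ} (hr : 0 < r) (h1 : vprof g r ≤ s) (h2 : s ≤ prof g r) :
    Kup g s r 2 = -Real.sqrt (level g - s) := by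
  rw [Kup, lowerPt_apply_two, flower_pol_thloS hg hr h1 h2]

/-- The height of the arcs: `z = -√(c - s)`. [folklore] -/
theorem Kdn_apply_two (hg : 1 ≤ g) {s r : ℝ} (hr : 0 < r) (h1 : vprof g r ≤ s) (h2 : s ≤ prof g r) :
    Kdn g s r 2 = -Real.sqrt (level g - s) := by
  rw [Kdn, lowerPt_apply_two, flower_pol_neg_thloS hg hr h1 h2]

/-- The arcs lie on the flower surface (`s ≤ c`, `vprof r ≤ s`). [folklore] -/
theorem Kup_mem_flowerSurface (hg : 1 ≤ g) {s r : ℝ} (hr : 0 < r) (h1 : vprof g r ≤ s) (hs : s ≤ level g) :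
    Kup g s r ∈ flowerSurface g := by
  refine lowerPt_mem ?_
  rcases le_or_gt s (prof g r) with h2 | h2
  · rw [flower_pol_thloS hg hr h1 h2]; exact hs
  · rw [thloS_eq_zero_of_prof_le hg hr h2.le, pol_zero_right, flower_ax']; exact h2.le.trans hs

/-- The arcs lie on the flower surface. [folklore] -/
theorem Kdn_mem_flowerSurface (hg : 1 ≤ g) {s r : ℝ} (hr : 0 < r) (h1 : vprof g r ≤ s) (hs : s ≤ level g) :
    Kdn g s r ∈ flowerSurface g := by
  refine lowerPt_mem ?_
  rw [flower_pol_neg]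
  rcases le_or_gt s (prof g r) with h2 | h2
  · rw [flower_pol_thloS hg hr h1 h2]; exact hs
  · rw [thloS_eq_zero_of_prof_le hg hr h2.le, pol_zero_right, flower_ax']; exact h2.le.trans hs

/-! ### §2 The radii `rIn s < r_a < rOut s` where the axis meets the level `s` -/

/-- There is a radius in `(0, ρ₁)` where `prof = s`, for `0 < s < c`. [folklore] -/
theorem exists_rIn (hg : 2 ≤ g) {s : ℝ} (hs0 : 0 < s) (hsc : s < level g) :
    ∃ r ∈ Ioo 0 (rho1 hg), prof g r = s := by
  have hg1 : 1 ≤ g := by omega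
  have h := intermediate_value_Ioo (rho1_pos hg).le (continuous_prof hg1).continuousOn
  rw [prof_zero hg1, prof_rho1 hg] at h
  obtain ⟨r, hr, hrs⟩ := h ⟨hs0, hsc⟩
  exact ⟨r, hr, hrs⟩

/-- There is a radius in `(7^{1/20g}, r_b)` where `prof = s`, for `prof(r_b) < s < c`. [folklore] -/
theorem exists_rOut (hg : 2 ≤ g) {s : ℝ} (hs0 : prof g (rb hg) < s) (hsc : s < level g) :
    ∃ r ∈ Ioo (rt g 7) (rb hg), prof g r = s := by
  have hg1 : 1 ≤ g := by omega
  have h := intermediate_value_Ioo' (rt_seven_lt_rb hg).le (continuous_prof hg1).continuousOn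
  rw [prof_rt_seven] at h
  obtain ⟨r, hr, hrs⟩ := h ⟨hs0, hsc⟩
  exact ⟨r, hr, hrs⟩

/-- `0 < s` when `prof(r_b) < s`. [folklore] -/
theorem pos_of_prof_rb_lt (hg : 2 ≤ g) {s : ℝ} (hsb : prof g (rb hg) < s) : 0 < s :=
  (prof_pos_of_pos (rb_pos hg)).trans hsb

/-- **The inner axis radius of the level `s`**: `prof(rIn s) = s`, `0 < rIn s < ρ₁`. [folklore] -/
def rIn (hg : 2 ≤ g) {s : ℝ} (hsb : prof g (rb hg) < s) (hsc : s < level g) : ℝ :=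
  Classical.choose (exists_rIn hg (pos_of_prof_rb_lt hg hsb) hsc)

/-- **The outer axis radius of the level `s`**: `prof(rOut s) = s`, `7^{1/20g} < rOut s < r_b`. [folklore] -/
def rOut (hg : 2 ≤ g) {s : ℝ} (hs0 : prof g (rb hg) < s) (hsc : s < level g) : ℝ :=
  Classical.choose (exists_rOut hg hs0 hsc)

section Radii

variable (hg : 2 ≤ g) {s : ℝ} (hsb : prof g (rb hg) < s) (hsc : s < level g)

/-- Bookkeeping (`rIn_mem`). [folklore] -/
theorem rIn_mem : rIn hg hsb hsc ∈ Ioo 0 (rho1 hg) :=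
  (Classical.choose_spec (exists_rIn hg (pos_of_prof_rb_lt hg hsb) hsc)).1

/-- Bookkeeping (`prof_rIn`). [folklore] -/
theorem prof_rIn : prof g (rIn hg hsb hsc) = s :=
  (Classical.choose_spec (exists_rIn hg (pos_of_prof_rb_lt hg hsb) hsc)).2

/-- Bookkeeping (`rOut_mem`). [folklore] -/
theorem rOut_mem : rOut hg hsb hsc ∈ Ioo (rt g 7) (rb hg) := (Classical.choose_spec (exists_rOut hg hsb hsc)).1

/-- Bookkeeping (`prof_rOut`). [folklore] -/
theorem prof_rOut : prof g (rOut hg hsb hsc) = s := (Classical.choose_spec (exists_rOut hg hsb hsc)).2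

/-- Bookkeeping (`rIn_pos`). [folklore] -/
theorem rIn_pos : 0 < rIn hg hsb hsc := (rIn_mem hg hsb hsc).1

/-- Bookkeeping (`rIn_lt_rho1`). [folklore] -/
theorem rIn_lt_rho1 : rIn hg hsb hsc < rho1 hg := (rIn_mem hg hsb hsc).2

/-- Bookkeeping (`rIn_lt_ra`). [folklore] -/
theorem rIn_lt_ra : rIn hg hsb hsc < ra hg := (rIn_lt_rho1 hg hsb hsc).trans (rho1_mem hg).2

/-- Bookkeeping (`rt_seven_lt_rOut`). [folklore] -/
theorem rt_seven_lt_rOut : rt g 7 < rOut hg hsb hsc := (rOut_mem hg hsb hsc).1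

/-- Bookkeeping (`rOut_lt_rb`). [folklore] -/
theorem rOut_lt_rb : rOut hg hsb hsc < rb hg := (rOut_mem hg hsb hsc).2

/-- Bookkeeping (`ra_lt_rOut`). [folklore] -/
theorem ra_lt_rOut : ra hg < rOut hg hsb hsc := (ra_lt_rt_seven hg).trans (rt_seven_lt_rOut hg hsb hsc)

/-- Bookkeeping (`rIn_lt_rOut`). [folklore] -/
theorem rIn_lt_rOut : rIn hg hsb hsc < rOut hg hsb hsc := (rIn_lt_ra hg hsb hsc).trans (ra_lt_rOut hg hsb hsc)

/-- Bookkeeping (`rOut_pos`). [folklore] -/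
theorem rOut_pos : 0 < rOut hg hsb hsc := (ra_pos hg).trans (ra_lt_rOut hg hsb hsc)

/-- **`prof ≥ s` exactly on `[rIn s, rOut s]`** (within `[0, r_b]`). [folklore] -/
theorem le_prof_iff {r : ℝ} (hr0 : 0 ≤ r) (hrb : r ≤ rb hg) :
    s ≤ prof g r ↔ rIn hg hsb hsc ≤ r ∧ r ≤ rOut hg hsb hsc := by
  have hIn := rIn_mem hg hsb hsc
  have hOut := rOut_mem hg hsb hsc
  have hρa := (rho1_mem hg).2
  have ha7 := ra_lt_rt_seven hg
  rcases le_or_gt r (ra hg) with hra | hra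
  · have key := (strictMonoOn_prof_left hg).le_iff_le ⟨hIn.1.le, (hIn.2.trans hρa).le⟩ ⟨hr0, hra⟩
    rw [prof_rIn hg hsb hsc] at key
    rw [key]
    constructor
    · intro h; exact ⟨h, hra.trans ((ra_lt_rOut hg hsb hsc).le)⟩
    · exact fun h => h.1
  · have key := (strictAntiOn_prof hg).le_iff_ge ⟨(ha7.trans hOut.1).le, hOut.2.le⟩ ⟨hra.le, hrb⟩
    rw [prof_rOut hg hsb hsc] at key
    rw [key]
    constructor
    · intro h; exact ⟨((hIn.2.trans hρa).trans hra).le, h⟩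
    · exact fun h => h.2

/-- `prof < s` off `[rIn s, rOut s]` (within `[0, r_b]`). [folklore] -/
theorem prof_lt_iff {r : ℝ} (hr0 : 0 ≤ r) (hrb : r ≤ rb hg) :
    prof g r < s ↔ r < rIn hg hsb hsc ∨ rOut hg hsb hsc < r := by
  rw [← not_le, le_prof_iff hg hsb hsc hr0 hrb, not_and_or, not_le, not_le]

include hsb in
/-- `vprof < s` on `[0, r_b]` when `prof(r_b) < s`. [folklore] -/
theorem vprof_lt_of_le_rb {r : ℝ} (hr0 : 0 ≤ r) (hrb : r ≤ rb hg) : vprof g r < s := by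
  have h1 : vprof g r ≤ vprof g (rb hg) := (strictMonoOn_vprof hg).monotoneOn hr0 (rb_pos hg).le hrb
  have h2 : vprof g (rb hg) < prof g (rb hg) := by
    rw [vprof, prof_eq]; linarith [V_pos (show 1 ≤ g by omega) (rb_pos hg)]
  linarith

/-- The floor angle vanishes exactly at the two axis radii (within `[rIn s, rOut s]`). [folklore] -/
theorem thloS_eq_zero_iff {r : ℝ} (hr : r ∈ Icc (rIn hg hsb hsc) (rOut hg hsb hsc)) :
    thloS g s r = 0 ↔ r = rIn hg hsb hsc ∨ r = rOut hg hsb hsc := by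
  have hg1 : 1 ≤ g := by omega
  have hr0 : 0 < r := (rIn_pos hg hsb hsc).trans_le hr.1
  have hrb : r ≤ rb hg := hr.2.trans (rOut_lt_rb hg hsb hsc).le
  have hsp : s ≤ prof g r := (le_prof_iff hg hsb hsc hr0.le hrb).2 hr
  have hV := V_pos hg1 hr0
  have hg' : (g : ℝ) ≠ 0 := by exact_mod_cast (show g ≠ 0 by omega)
  have hx1 : (s - r ^ 2) / V g r ≤ 1 := by rw [div_le_one hV, prof_eq] at *; linarith
  rw [thloS, div_eq_zero_iff, or_iff_left hg', min_eq_right hx1, Real.arccos_eq_zero, le_div_iff₀ hV, one_mul]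
  constructor
  · intro h
    have hps : prof g r ≤ s := by rw [prof_eq]; linarith
    have heq : prof g r = s := le_antisymm hps hsp
    rcases le_or_gt r (ra hg) with hra | hra
    · left
      exact (strictMonoOn_prof_left hg).injOn ⟨hr0.le, hra⟩
        ⟨(rIn_pos hg hsb hsc).le, (rIn_lt_ra hg hsb hsc).le⟩ (heq.trans (prof_rIn hg hsb hsc).symm)
    · right
      exact (strictAntiOn_prof hg).injOn ⟨hra.le, hrb⟩
        ⟨(ra_lt_rOut hg hsb hsc).le, (rOut_lt_rb hg hsb hsc).le⟩ (heq.trans (prof_rOut hg hsb hsc).symm)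
  · rintro (rfl | rfl)
    · rw [V_eq, prof_rIn hg hsb hsc]
    · rw [V_eq, prof_rOut hg hsb hsc]

/-- The outer axis point of the hole circle is `Cdn(rOut s)`. [folklore] -/
theorem Kup_rOut : Kup g s (rOut hg hsb hsc) = Cdn g (rOut hg hsb hsc) :=
  Kup_eq_Cdn_of ((thloS_eq_zero_iff hg hsb hsc ⟨(rIn_lt_rOut hg hsb hsc).le, le_rfl⟩).2 (Or.inr rfl))

/-- The outer axis point of the hole circle is `Cdn(rOut s)`. [folklore] -/
theorem Kdn_rOut : Kdn g s (rOut hg hsb hsc) = Cdn g (rOut hg hsb hsc) :=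
  Kdn_eq_Cdn_of ((thloS_eq_zero_iff hg hsb hsc ⟨(rIn_lt_rOut hg hsb hsc).le, le_rfl⟩).2 (Or.inr rfl))

/-- The inner axis point: `Kup s (rIn s) = Kdn s (rIn s)`. [folklore] -/
theorem Kup_rIn_eq_Kdn_rIn : Kup g s (rIn hg hsb hsc) = Kdn g s (rIn hg hsb hsc) := by
  have h := (thloS_eq_zero_iff hg hsb hsc ⟨le_rfl, (rIn_lt_rOut hg hsb hsc).le⟩).2 (Or.inl rfl)
  rw [Kup_eq_Cdn_of h, Kdn_eq_Cdn_of h]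

/-- **The `y`-coordinate vanishes only at the two axis radii.** [folklore] -/
theorem Kup_apply_one_pos {r : ℝ} (h1 : rIn hg hsb hsc < r) (h2 : r < rOut hg hsb hsc) : 0 < Kup g s r 1 := by
  have hg1 : 1 ≤ g := by omega
  have hr0 : 0 < r := (rIn_pos hg hsb hsc).trans h1
  rw [Kup_apply_one]
  refine mul_pos hr0 (Real.sin_pos_of_pos_of_lt_pi ?_ ?_)
  · refine lt_of_le_of_ne (thloS_nonneg s r) fun h => ?_
    rcases (thloS_eq_zero_iff hg hsb hsc ⟨h1.le, h2.le⟩).1 h.symm with h' | h' <;> linarith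
  · exact (thloS_le hg1 s r).trans_lt ((pi_div_le_pi_div_two hg).trans_lt (by linarith [Real.pi_pos]))

/-- The `y`-coordinate of the lower arc is negative strictly between the axis radii. [folklore] -/
theorem Kdn_apply_one_neg {r : ℝ} (h1 : rIn hg hsb hsc < r) (h2 : r < rOut hg hsb hsc) : Kdn g s r 1 < 0 := by
  have h := Kup_apply_one_pos hg hsb hsc h1 h2
  rw [Kup_apply_one] at h
  rw [Kdn_apply_one]
  linarith

end Radii

/-! ### §3 The open standard sector of the plane; confinement of level curves -/

variable (g) in
/-- **The open standard sector** `{x > 0, |y| cos(π/g) < x sin(π/g)}` (`= {r > 0, |arg| < π/g}` for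
`g ≥ 2`). [folklore] -/
def osec : Set (𝔼 2) := {u | 0 < u 0 ∧ |u 1| * Real.cos (π / g) < u 0 * Real.sin (π / g)}

/-- The open sector is open. [folklore] -/
theorem isOpen_osec : IsOpen (osec g) := by
  have h0 : Continuous fun u : 𝔼 2 => u 0 := (EuclideanSpace.proj (0 : Fin 2)).continuous
  have h1 : Continuous fun u : 𝔼 2 => u 1 := (EuclideanSpace.proj (1 : Fin 2)).continuous
  exact (isOpen_lt continuous_const h0).inter
    (isOpen_lt ((continuous_abs.comp h1).mul continuous_const) (h0.mul continuous_const))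

/-- `cos(π/g) ≥ 0` and `sin(π/g) > 0` (`g ≥ 2`). [folklore] -/
theorem cos_pi_div_nonneg (hg : 2 ≤ g) : 0 ≤ Real.cos (π / g) :=
  Real.cos_nonneg_of_neg_pi_div_two_le_of_le (by linarith [Real.pi_pos, pi_div_pos hg])
    (pi_div_le_pi_div_two hg)

/-- `sin(π/g) > 0` (`g ≥ 2`). [folklore] -/
theorem sin_pi_div_pos (hg : 2 ≤ g) : 0 < Real.sin (π / g) :=
  Real.sin_pos_of_pos_of_lt_pi (pi_div_pos hg) ((pi_div_le_pi_div_two hg).trans_lt (by linarith [Real.pi_pos]))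

/-- **Polar points with `|φ| < π/g` lie in the open sector.** [folklore] -/
theorem pol_mem_osec (hg : 2 ≤ g) {r φ : ℝ} (hr : 0 < r) (hφ : |φ| < π / g) : pol r φ ∈ osec g := by
  have hπg2 := pi_div_le_pi_div_two hg
  have hφ2 := abs_lt.1 (hφ.trans_le hπg2)
  have hφ' := abs_lt.1 hφ
  have hcos : 0 < Real.cos φ := Real.cos_pos_of_mem_Ioo ⟨hφ2.1, hφ2.2⟩
  refine ⟨by rw [pol_apply_zero]; exact mul_pos hr hcos, ?_⟩
  rw [pol_apply_zero, pol_apply_one]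
  rcases le_total 0 φ with h | h
  · have hs : 0 ≤ Real.sin φ := Real.sin_nonneg_of_nonneg_of_le_pi h (by linarith [Real.pi_pos])
    rw [abs_of_nonneg (mul_nonneg hr.le hs)]
    have key : 0 < r * Real.sin (π / g - φ) :=
      mul_pos hr (Real.sin_pos_of_pos_of_lt_pi (by linarith) (by linarith [Real.pi_pos]))
    rw [Real.sin_sub] at key
    nlinarith
  · have hs : Real.sin φ ≤ 0 := Real.sin_nonpos_of_nonpos_of_neg_pi_le h (by linarith [Real.pi_pos])
    rw [abs_of_nonpos (mul_nonpos_of_nonneg_of_nonpos hr.le hs)]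
    have key : 0 < r * Real.sin (π / g + φ) :=
      mul_pos hr (Real.sin_pos_of_pos_of_lt_pi (by linarith) (by linarith [Real.pi_pos]))
    rw [Real.sin_add] at key
    nlinarith

/-- **Points of the open sector have `|arg| < π/g`** (and are non-zero). [folklore] -/
theorem abs_arg_lt_of_mem_osec (hg : 2 ≤ g) {u : 𝔼 2} (hu : u ∈ osec g) :
    u ≠ 0 ∧ |Complex.arg (toC u)| < π / g := by
  have hπg2 := pi_div_le_pi_div_two hg
  have hu0 : u ≠ 0 := fun h => by
    have h1 := hu.1
    rw [h] at h1
    simp at h1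
  refine ⟨hu0, ?_⟩
  set r := ‖u‖ with hr
  set φ := Complex.arg (toC u) with hφ
  have hr0 : 0 < r := norm_pos_iff.2 hu0
  have hpol : pol r φ = u := by rw [hφ, ← ang_zero_left]; exact pol_norm_ang 0 u
  have hφm : φ ∈ Ioc (-π) π := ⟨Complex.neg_pi_lt_arg _, Complex.arg_le_pi _⟩
  have hx : u 0 = r * Real.cos φ := by rw [← hpol, pol_apply_zero]
  have hy : u 1 = r * Real.sin φ := by rw [← hpol, pol_apply_one]
  obtain ⟨h1, h2⟩ := hu
  rw [hx] at h1 h2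
  rw [hy] at h2
  have hcos : 0 < Real.cos φ := pos_of_mul_pos_right h1 hr0.le
  -- `|φ| < π/2`
  have hφ2 : |φ| < π / 2 := by
    rw [abs_lt]
    constructor
    · by_contra h; push Not at h
      have : Real.cos φ ≤ 0 := by
        rw [← Real.cos_neg]
        exact Real.cos_nonpos_of_pi_div_two_le_of_le (by linarith) (by linarith [hφm.1])
      linarith
    · by_contra h; push Not at h
      have : Real.cos φ ≤ 0 := Real.cos_nonpos_of_pi_div_two_le_of_le h (by linarith [hφm.2])
      linarith
  have hφ2' := abs_lt.1 hφ2
  rw [abs_lt]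
  rcases le_total 0 φ with h | h
  · have hs : 0 ≤ Real.sin φ := Real.sin_nonneg_of_nonneg_of_le_pi h (by linarith)
    rw [abs_of_nonneg (mul_nonneg hr0.le hs)] at h2
    refine ⟨by linarith [pi_div_pos hg], ?_⟩
    by_contra h'; push Not at h'
    -- `π/g ≤ φ < π/2`: `sin(π/g - φ) ≤ 0`
    have key : Real.sin (π / g - φ) ≤ 0 :=
      Real.sin_nonpos_of_nonpos_of_neg_pi_le (by linarith) (by linarith [pi_div_pos hg, Real.pi_pos])
    rw [Real.sin_sub] at key
    nlinarith
  · have hs : Real.sin φ ≤ 0 := Real.sin_nonpos_of_nonpos_of_neg_pi_le h (by linarith)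
    rw [abs_of_nonpos (mul_nonpos_of_nonneg_of_nonpos hr0.le hs)] at h2
    refine ⟨?_, by linarith [pi_div_pos hg]⟩
    by_contra h'; push Not at h'
    have key : Real.sin (π / g + φ) ≤ 0 :=
      Real.sin_nonpos_of_nonpos_of_neg_pi_le (by linarith) (by linarith [pi_div_pos hg, Real.pi_pos])
    rw [Real.sin_add] at key
    nlinarith

/-- Points of the open sector inside the flower domain lie in the standard wedge. [folklore] -/
theorem mem_wedge_of_mem_osec (hg : 2 ≤ g) {u : 𝔼 2} (hu : u ∈ osec g) (hq : flower g u ≤ level g) :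
    u ∈ wedge g :=
  ⟨hq, (abs_arg_lt_of_mem_osec hg hu).2.le⟩

/-- **A point with standard angle in `[0, π/g)` lies in none of the wedges `1, …, g-1`.** [folklore] -/
theorem not_mem_secW_of_ang_nonneg (hg : 2 ≤ g) {k : ℕ} (hk1 : 1 ≤ k) (hkg : k + 1 ≤ g) {u : 𝔼 2}
    (hu : u ≠ 0) (hα : ang 0 u ∈ Ico 0 (π / g)) : u ∉ secW g k := by
  rintro ⟨-, hβ⟩
  set α := ang 0 u with hαdef
  have hG : (0 : ℝ) < g := by exact_mod_cast (show 0 < g by omega)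
  have hK : (1 : ℝ) ≤ k := by exact_mod_cast hk1
  have hKG : (k : ℝ) + 1 ≤ g := by exact_mod_cast hkg
  have hπ := Real.pi_pos
  have hπg : 0 < π / g := div_pos hπ hG
  have hνk : νk g k = -(2 * k * π / g) := rfl
  have hlo : 2 * (π / g) ≤ 2 * k * π / g := by
    rw [mul_div_assoc', div_le_div_iff_of_pos_right hG]; nlinarith
  have hhi : 2 * k * π / g + 2 * (π / g) ≤ 2 * π := by
    rw [mul_div_assoc' 2 π, ← add_div, div_le_iff₀ hG]; nlinarith
  by_cases hcase : α + 2 * k * π / g ≤ π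
  · have heq : ang (νk g k) u = α :=
      ang_eq_of_mem hu (by rw [hνk]; exact ⟨by linarith [hα.1], by linarith⟩)
    have h2 := hβ.2
    rw [heq, hνk] at h2
    -- `α ≤ νk + π/g = -(2k-1)π/g < 0`
    have h4 : 2 * k * π / g = 2 * k * (π / g) := by ring
    rw [h4] at h2
    nlinarith [hα.1]
  · push Not at hcase
    have heq : ang (νk g k + 2 * π) u = α :=
      ang_eq_of_mem hu (by rw [hνk]; exact ⟨by linarith, by linarith [hα.2]⟩)
    rw [ang_add_two_pi] at heq
    have h1 := hβ.1
    have h5 : ang (νk g k) u = α - 2 * π := by linarith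
    rw [h5, hνk] at h1
    have h4 : 2 * k * π / g = 2 * k * (π / g) := by ring
    rw [h4] at h1 hhi
    nlinarith [hα.2]

/-- **Points of the open sector lie in none of the wedges `1, …, g-1`.** [folklore] -/
theorem not_mem_secW_of_mem_osec (hg : 2 ≤ g) {u : 𝔼 2} (hu : u ∈ osec g) {k : ℕ} (hk1 : 1 ≤ k)
    (hkg : k + 1 ≤ g) : u ∉ secW g k := by
  obtain ⟨hu0, hα⟩ := abs_arg_lt_of_mem_osec hg hu
  rw [← ang_zero_left] at hα
  rcases lt_or_ge (ang 0 u) 0 with h | h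
  · exact not_mem_secW_of_ang hg hk1 hkg hu0 ⟨(abs_lt.1 hα).1, h⟩
  · exact not_mem_secW_of_ang_nonneg hg hk1 hkg hu0 ⟨h, (abs_lt.1 hα).2⟩

/-- A planar point with prescribed coordinates `(λ cos θ, λ sin θ)` is `pol λ θ`. [folklore] -/
theorem eq_pol_of_apply {u : 𝔼 2} {l θ : ℝ} (h0 : u 0 = l * Real.cos θ) (h1 : u 1 = l * Real.sin θ) :
    u = pol l θ := by
  rw [eq_smul_add_smul u, eq_smul_add_smul (pol l θ), pol_apply_zero, pol_apply_one, h0, h1]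

/-- **The frontier of the open sector consists of valley-ray points** `pol r (±π/g)`, `r ≥ 0`. [folklore] -/
theorem exists_eq_pol_valley_of_frontier (hg : 2 ≤ g) {u : 𝔼 2} (hu : u ∈ closure (osec g)) (hu' : u ∉ osec g) :
    ∃ r : ℝ, 0 ≤ r ∧ (u = pol r (π / g) ∨ u = pol r (-(π / g))) := by
  set co := Real.cos (π / g) with hco
  set si := Real.sin (π / g) with hsi
  have hco0 : 0 ≤ co := cos_pi_div_nonneg hg
  have hsi0 : 0 < si := sin_pi_div_pos hg
  -- the closure lies in the closed sector
  have hC : closure (osec g) ⊆ {u : 𝔼 2 | 0 ≤ u 0 ∧ |u 1| * co ≤ u 0 * si} := by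
    have h0 : Continuous fun u : 𝔼 2 => u 0 := (EuclideanSpace.proj (0 : Fin 2)).continuous
    have h1 : Continuous fun u : 𝔼 2 => u 1 := (EuclideanSpace.proj (1 : Fin 2)).continuous
    refine closure_minimal (fun u hu => ⟨hu.1.le, hu.2.le⟩) ?_
    exact (isClosed_le continuous_const h0).inter
      (isClosed_le ((continuous_abs.comp h1).mul continuous_const) (h0.mul continuous_const))
  obtain ⟨hx, hle⟩ := hC hu
  have hE : |u 1| * co = u 0 * si := by
    refine le_antisymm hle ?_
    by_contra h; push Not at h
    rcases hx.eq_or_lt with h' | h'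
    · rw [← h', zero_mul] at h
      exact absurd h (not_lt.2 (mul_nonneg (abs_nonneg _) hco0))
    · exact hu' ⟨h', h⟩
  have hpy : co ^ 2 + si ^ 2 = 1 := by rw [hco, hsi]; exact Real.cos_sq_add_sin_sq _
  set l := u 0 * co + |u 1| * si with hl
  have hl0 : 0 ≤ l := add_nonneg (mul_nonneg hx hco0) (mul_nonneg (abs_nonneg _) hsi0.le)
  have hX : u 0 = l * co := by
    have : l * co = u 0 * co ^ 2 + |u 1| * co * si := by rw [hl]; ring
    rw [this, hE]; linear_combination (-(u 0)) * hpy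
  have hY : |u 1| = l * si := by
    have : l * si = u 0 * si * co + |u 1| * si ^ 2 := by rw [hl]; ring
    rw [this, ← hE]; linear_combination (-|u 1|) * hpy
  refine ⟨l, hl0, ?_⟩
  rcases le_total 0 (u 1) with hy | hy
  · left
    rw [abs_of_nonneg hy] at hY
    exact eq_pol_of_apply hX hY
  · right
    rw [abs_of_nonpos hy] at hY
    refine eq_pol_of_apply (by rw [Real.cos_neg]; exact hX) ?_
    rw [Real.sin_neg, mul_neg]; linarith

/-- **Confinement of level curves.**  A continuous planar curve of constant level
`s > prof(r_b)` starting in `osec ∩ {r < r_b}` stays there: it can reach neither the circle `r = r_b`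
(where `q_g ≤ prof(r_b) < s`) nor the frontier of the sector (valley rays, where
`q_g = vprof(r) < s` for `r ≤ r_b`). [folklore] -/
theorem curve_mem_osec_of_level (hg : 2 ≤ g) {c : ℝ → 𝔼 2} (hc : Continuous c) {s : ℝ}
    (hsb : prof g (rb hg) < s) (hlev : ∀ t, flower g (c t) = s) (h0 : c 0 ∈ osec g)
    (h0r : ‖c 0‖ < rb hg) (t : ℝ) : c t ∈ osec g ∧ ‖c t‖ < rb hg := by
  have hg1 : 1 ≤ g := by omega
  -- the radius stays `< r_b`
  have hrad : ∀ t, ‖c t‖ < rb hg := by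
    intro t
    by_contra hle
    push Not at hle
    obtain ⟨t', -, ht'⟩ : rb hg ∈ (fun t => ‖c t‖) '' uIcc 0 t :=
      intermediate_value_uIcc (continuous_norm.comp hc).continuousOn (mem_uIcc.2 (Or.inl ⟨h0r.le, hle⟩))
    have hu : c t' = pol (rb hg) (ang 0 (c t')) := by
      have h := pol_norm_ang 0 (c t')
      rw [show ‖c t'‖ = rb hg from ht'] at h
      exact h.symm
    have hq : flower g (c t') ≤ prof g (rb hg) := by rw [hu]; exact flower_pol_le_prof (rb_pos hg).le _
    linarith [hlev t']
  refine ⟨?_, hrad t⟩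
  -- the curve never meets the frontier of the sector
  have hsub : range c ⊆ osec g ∪ (closure (osec g))ᶜ := by
    rintro _ ⟨t', rfl⟩
    by_cases h1 : c t' ∈ osec g
    · exact Or.inl h1
    · refine Or.inr fun h2 => ?_
      obtain ⟨r, hr0, hu⟩ := exists_eq_pol_valley_of_frontier hg h2 h1
      have hr : r < rb hg := by
        have h := hrad t'
        rcases hu with hu | hu <;> rw [hu, norm_pol_of_nonneg hr0] at h <;> exact h
      have hq : flower g (c t') = vprof g r := by
        rcases hu with hu | hu
        · rw [hu, flower_pol_valley hg1]
        · rw [hu, flower_pol_neg, flower_pol_valley hg1]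
      have h3 := vprof_lt_of_le_rb hg hsb hr0 hr.le
      linarith [hlev t']
  exact (isPreconnected_range hc).subset_left_of_subset_union isOpen_osec isClosed_closure.isOpen_compl
    (disjoint_compl_right.mono_right (compl_subset_compl.2 subset_closure)) hsub
    ⟨c 0, mem_range_self 0, h0⟩ (mem_range_self t)

/-! ### §4 The lower hole circle of the standard sector at level `s` -/

/-- **The lower hole circle at level `s`**: the points of the lower sheet of the flower surface over
the level curve `{q_g = s}` inside the open sector and the disc `r < r_b`. [folklore] -/
def holeC (hg : 2 ≤ g) (s : ℝ) : Set (𝔼 3) :=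
  {p | flower g (proj p) = s ∧ p 2 < 0 ∧ thicken (flower g) p = level g ∧ proj p ∈ osec g ∧ ‖proj p‖ < rb hg}

section HoleC

variable (hg : 2 ≤ g) {s : ℝ} (hsb : prof g (rb hg) < s) (hsc : s < level g)

include hsb hsc in
/-- The arcs over `[rIn s, rOut s]` lie on the hole circle. [folklore] -/
theorem Kup_mem_holeC {r : ℝ} (hr : r ∈ Icc (rIn hg hsb hsc) (rOut hg hsb hsc)) : Kup g s r ∈ holeC hg s := by
  have hg1 : 1 ≤ g := by omega
  have hr0 : 0 < r := (rIn_pos hg hsb hsc).trans_le hr.1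
  have hrb : r < rb hg := hr.2.trans_lt (rOut_lt_rb hg hsb hsc)
  have hv : vprof g r ≤ s := (vprof_lt_of_le_rb hg hsb hr0.le hrb.le).le
  have hp : s ≤ prof g r := (le_prof_iff hg hsb hsc hr0.le hrb.le).2 hr
  refine ⟨flower_proj_Kup hg1 hr0 hv hp, ?_, Kup_mem_flowerSurface hg1 hr0 hv hsc.le, ?_, ?_⟩
  · rw [Kup_apply_two hg1 hr0 hv hp, neg_lt_zero]; exact Real.sqrt_pos.2 (by linarith)
  · rw [proj_Kup]
    exact pol_mem_osec hg hr0 (by rw [abs_of_nonneg (thloS_nonneg s r)]; exact thloS_lt hg1 hr0 (vprof_lt_of_le_rb hg hsb hr0.le hrb.le))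
  · rw [proj_Kup, norm_pol_of_nonneg hr0.le]; exact hrb

include hsb hsc in
/-- The arcs over `[rIn s, rOut s]` lie on the hole circle. [folklore] -/
theorem Kdn_mem_holeC {r : ℝ} (hr : r ∈ Icc (rIn hg hsb hsc) (rOut hg hsb hsc)) : Kdn g s r ∈ holeC hg s := by
  have hg1 : 1 ≤ g := by omega
  have hr0 : 0 < r := (rIn_pos hg hsb hsc).trans_le hr.1
  have hrb : r < rb hg := hr.2.trans_lt (rOut_lt_rb hg hsb hsc)
  have hv : vprof g r ≤ s := (vprof_lt_of_le_rb hg hsb hr0.le hrb.le).le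
  have hp : s ≤ prof g r := (le_prof_iff hg hsb hsc hr0.le hrb.le).2 hr
  refine ⟨flower_proj_Kdn hg1 hr0 hv hp, ?_, Kdn_mem_flowerSurface hg1 hr0 hv hsc.le, ?_, ?_⟩
  · rw [Kdn_apply_two hg1 hr0 hv hp, neg_lt_zero]; exact Real.sqrt_pos.2 (by linarith)
  · rw [proj_Kdn]
    exact pol_mem_osec hg hr0 (by rw [abs_neg, abs_of_nonneg (thloS_nonneg s r)]; exact thloS_lt hg1 hr0 (vprof_lt_of_le_rb hg hsb hr0.le hrb.le))
  · rw [proj_Kdn, norm_pol_of_nonneg hr0.le]; exact hrb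

include hsb hsc in
/-- **Description of the hole circle**: its points are `Kup s r` (if `y ≥ 0`) or `Kdn s r`
(if `y ≤ 0`) with `r = ‖π p‖ ∈ [rIn s, rOut s]`. [folklore] -/
theorem eq_of_mem_holeC {p : 𝔼 3} (hp : p ∈ holeC hg s) :
    ‖proj p‖ ∈ Icc (rIn hg hsb hsc) (rOut hg hsb hsc) ∧
      (0 ≤ p 1 → p = Kup g s ‖proj p‖) ∧ (p 1 ≤ 0 → p = Kdn g s ‖proj p‖) := by
  have hg1 : 1 ≤ g := by omega
  have hG : (0 : ℝ) < g := by exact_mod_cast (show 0 < g by omega)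
  obtain ⟨hq, hz, hth, ho, hrb⟩ := hp
  obtain ⟨hu0, harg⟩ := abs_arg_lt_of_mem_osec hg ho
  set u := proj p with hu
  set r := ‖u‖ with hr
  set φ := Complex.arg (toC u) with hφ
  have hr0 : 0 < r := norm_pos_iff.2 hu0
  have hpol : pol r φ = u := by rw [hφ, ← ang_zero_left]; exact pol_norm_ang 0 u
  have hV := V_pos hg1 hr0
  -- the level equation in polar coordinates
  have hcos : Real.cos (g * φ) = (s - r ^ 2) / V g r := by
    rw [eq_div_iff hV.ne']
    have h := hq
    rw [← hpol, flower_pol] at h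
    linarith
  have hgφ : |(g : ℝ) * φ| < π := by
    rw [abs_mul, abs_of_pos hG]
    calc (g : ℝ) * |φ| < g * (π / g) := mul_lt_mul_of_pos_left harg hG
      _ = π := mul_div_cancel₀ _ hG.ne'
  have hx1 : (s - r ^ 2) / V g r ≤ 1 := hcos ▸ Real.cos_le_one _
  have hprof : s ≤ prof g r := by rw [div_le_one hV] at hx1; rw [prof_eq]; linarith
  have hmem : r ∈ Icc (rIn hg hsb hsc) (rOut hg hsb hsc) := (le_prof_iff hg hsb hsc hr0.le hrb.le).1 hprof
  -- `|φ| = θ_s(r)`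
  have habs : |φ| = thloS g s r := by
    have h1 : Real.cos ((g : ℝ) * |φ|) = (s - r ^ 2) / V g r := by
      rw [← hcos]
      rcases abs_choice φ with h | h
      · rw [h]
      · rw [h, mul_neg, Real.cos_neg]
    have h2 : (g : ℝ) * |φ| = Real.arccos ((s - r ^ 2) / V g r) := by
      rw [← h1, Real.arccos_cos (by positivity) ?_]
      calc (g : ℝ) * |φ| ≤ g * (π / g) := mul_le_mul_of_nonneg_left harg.le hG.le
        _ = π := mul_div_cancel₀ _ hG.ne'
    rw [thloS, min_eq_right hx1, ← h2, mul_div_cancel_left₀ _ hG.ne']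
  have hy' : p 1 = r * Real.sin φ := by rw [← proj_apply_one p, ← hu, ← hpol, pol_apply_one]
  have hπφ : -π < φ ∧ φ < π := by
    have := abs_lt.1 (harg.trans_le ((pi_div_le_pi_div_two hg).trans (by linarith [Real.pi_pos] : π / 2 ≤ π)))
    exact ⟨this.1, this.2⟩
  have hplow : p = lowerPt (flower g) (level g) u := eq_lowerPt_of_mem hth hz.le
  refine ⟨hmem, fun hy => ?_, fun hy => ?_⟩
  · have hφ0 : 0 ≤ φ := by
      by_contra h; push Not at h
      have := Real.sin_neg_of_neg_of_neg_pi_lt h hπφ.1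
      nlinarith
    have hφeq : thloS g s r = φ := by rw [← habs, abs_of_nonneg hφ0]
    rw [Kup, hφeq, hpol]
    exact hplow
  · have hφ0 : φ ≤ 0 := by
      by_contra h; push Not at h
      have := Real.sin_pos_of_pos_of_lt_pi h hπφ.2
      nlinarith
    have hφeq : -thloS g s r = φ := by rw [← habs, abs_of_nonpos hφ0, neg_neg]
    rw [Kdn, hφeq, hpol]
    exact hplow

include hsb hsc in
/-- **The hole circle is the union of its two arcs over `[rIn s, rOut s]`.** [folklore] -/
theorem holeC_eq_union :
    holeC hg s = Kup g s '' Icc (rIn hg hsb hsc) (rOut hg hsb hsc) ∪ Kdn g s '' Icc (rIn hg hsb hsc) (rOut hg hsb hsc) := by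
  ext p
  constructor
  · intro hp
    obtain ⟨hr, h1, h2⟩ := eq_of_mem_holeC hg hsb hsc hp
    rcases le_total 0 (p 1) with hy | hy
    · exact Or.inl ⟨_, hr, (h1 hy).symm⟩
    · exact Or.inr ⟨_, hr, (h2 hy).symm⟩
  · rintro (⟨r, hr, rfl⟩ | ⟨r, hr, rfl⟩)
    · exact Kup_mem_holeC hg hsb hsc hr
    · exact Kdn_mem_holeC hg hsb hsc hr

include hsb hsc in
/-- **The hole circle is connected** (two arcs with a common end point). [folklore] -/
theorem isConnected_holeC : IsConnected (holeC hg s) := by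
  have hg1 : 1 ≤ g := by omega
  have hI : IsConnected (Icc (rIn hg hsb hsc) (rOut hg hsb hsc)) := isConnected_Icc (rIn_lt_rOut hg hsb hsc).le
  have hsub : Icc (rIn hg hsb hsc) (rOut hg hsb hsc) ⊆ Ioi 0 := fun r hr => (rIn_pos hg hsb hsc).trans_le hr.1
  have h1 : IsConnected (Kup g s '' Icc (rIn hg hsb hsc) (rOut hg hsb hsc)) :=
    hI.image _ ((continuousOn_Kup hg1 s).mono hsub)
  have h2 : IsConnected (Kdn g s '' Icc (rIn hg hsb hsc) (rOut hg hsb hsc)) :=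
    hI.image _ ((continuousOn_Kdn hg1 s).mono hsub)
  rw [holeC_eq_union hg hsb hsc]
  refine IsConnected.union ⟨Kup g s (rOut hg hsb hsc), ⟨_, ⟨(rIn_lt_rOut hg hsb hsc).le, le_rfl⟩, rfl⟩,
    ⟨_, ⟨(rIn_lt_rOut hg hsb hsc).le, le_rfl⟩, ?_⟩⟩ h1 h2
  rw [Kdn_rOut, Kup_rOut]

include hsb hsc in
/-- The outer axis point `Cdn(rOut s)` lies on the hole circle. [folklore] -/
theorem Cdn_rOut_mem_holeC : Cdn g (rOut hg hsb hsc) ∈ holeC hg s := by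
  rw [← Kup_rOut hg hsb hsc]
  exact Kup_mem_holeC hg hsb hsc ⟨(rIn_lt_rOut hg hsb hsc).le, le_rfl⟩

include hsb hsc in
/-- The inner axis point `Kup s (rIn s)` lies on the hole circle. [folklore] -/
theorem Kup_rIn_mem_holeC : Kup g s (rIn hg hsb hsc) ∈ holeC hg s :=
  Kup_mem_holeC hg hsb hsc ⟨le_rfl, (rIn_lt_rOut hg hsb hsc).le⟩

include hsb hsc in
/-- **On the hole circle, `y = 0` exactly at the two axis points.** [folklore] -/
theorem apply_one_eq_zero_iff_of_mem_holeC {p : 𝔼 3} (hp : p ∈ holeC hg s) :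
    p 1 = 0 ↔ p = Kup g s (rIn hg hsb hsc) ∨ p = Cdn g (rOut hg hsb hsc) := by
  obtain ⟨hr, h1, h2⟩ := eq_of_mem_holeC hg hsb hsc hp
  constructor
  · intro h0
    have hpe := h1 h0.ge
    have hy : Kup g s ‖proj p‖ 1 = 0 := by rw [← hpe]; exact h0
    rw [Kup_apply_one] at hy
    have hr0 : 0 < ‖proj p‖ := (rIn_pos hg hsb hsc).trans_le hr.1
    have hsin : Real.sin (thloS g s ‖proj p‖) = 0 := by
      rcases mul_eq_zero.1 hy with h | h
      · exact absurd h hr0.ne'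
      · exact h
    have hth : thloS g s ‖proj p‖ = 0 := by
      have hle := thloS_le (show 1 ≤ g by omega) s ‖proj p‖
      have hlt : thloS g s ‖proj p‖ < π := hle.trans_lt ((pi_div_le_pi_div_two hg).trans_lt (by linarith [Real.pi_pos]))
      rcases (thloS_nonneg s ‖proj p‖).eq_or_lt with h | h
      · exact h.symm
      · exact absurd hsin (Real.sin_pos_of_pos_of_lt_pi h hlt).ne'
    rcases (thloS_eq_zero_iff hg hsb hsc hr).1 hth with h | h
    · left; rw [hpe, h]
    · right; rw [hpe, h, Kup_rOut]
  · rintro (h | h)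
    · rw [h, Kup_apply_one, (thloS_eq_zero_iff hg hsb hsc ⟨le_rfl, (rIn_lt_rOut hg hsb hsc).le⟩).2 (Or.inl rfl),
        Real.sin_zero, mul_zero]
    · rw [h, Cdn_apply_one]

/-- The height on the hole circle is `-√(c - s)`. [folklore] -/
theorem apply_two_of_mem_holeC {p : 𝔼 3} (hp : p ∈ holeC hg s) : p 2 = -Real.sqrt (level g - s) := by
  have h : p 2 ^ 2 = level g - s := by
    have := hp.2.2.1
    rw [thicken_apply, hp.1] at this
    linarith
  have h2 : Real.sqrt (level g - s) = -p 2 := by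
    rw [← h, Real.sqrt_sq_eq_abs, abs_of_neg hp.2.1]
  linarith

/-- The level pair `H = (q_g ∘ π, z)` on the hole circle. [folklore] -/
theorem levelPair_of_mem_holeC {p : 𝔼 3} (hp : p ∈ holeC hg s) :
    levelPair (flower g) p = (s, -Real.sqrt (level g - s)) := by
  rw [levelPair_apply, hp.1, apply_two_of_mem_holeC hg hp]

include hsc in
/-- **Membership in the hole circle from the level pair and the position.** [folklore] -/
theorem mem_holeC_of_levelPair {p : 𝔼 3} (hH : levelPair (flower g) p = (s, -Real.sqrt (level g - s)))
    (ho : proj p ∈ osec g) (hr : ‖proj p‖ < rb hg) : p ∈ holeC hg s := by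
  rw [levelPair_apply, Prod.mk.injEq] at hH
  have hz : p 2 < 0 := by rw [hH.2, neg_lt_zero]; exact Real.sqrt_pos.2 (by linarith)
  refine ⟨hH.1, hz, ?_, ho, hr⟩
  rw [thicken_apply, hH.1, hH.2, neg_sq, Real.sq_sqrt (by linarith)]
  ring

include hsc in
/-- The hole circle lies in the standard sector. [folklore] -/
theorem holeC_subset_sectorZ : holeC hg s ⊆ sectorZ g := fun p hp =>
  ⟨hp.2.2.1, mem_wedge_of_mem_osec hg hp.2.2.2.1 (by rw [hp.1]; exact hsc.le)⟩

include hsb hsc in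
/-- The hole circle is closed. [folklore] -/
theorem isClosed_holeC : IsClosed (holeC hg s) := by
  have hg1 : 1 ≤ g := by omega
  rw [holeC_eq_union hg hsb hsc]
  have hsub : Icc (rIn hg hsb hsc) (rOut hg hsb hsc) ⊆ Ioi 0 := fun r hr => (rIn_pos hg hsb hsc).trans_le hr.1
  exact ((isCompact_Icc.image_of_continuousOn ((continuousOn_Kup hg1 s).mono hsub)).isClosed).union
    ((isCompact_Icc.image_of_continuousOn ((continuousOn_Kdn hg1 s).mono hsub)).isClosed)

end HoleC


/-! ### §5 The orbit of an `H`-preserving flow through the hole circle is the hole circle -/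

section Flow

variable (hg : 2 ≤ g) {s : ℝ} (hsb : prof g (rb hg) < s) (hsc : s < level g)
variable {θ : ℝ × 𝔼 3 → 𝔼 3} {ψ : 𝔼 3 → ℝ}

include hsb hsc in
/-- **Orbits through the hole circle stay on it**: `H = (q_g ∘ π, z)` is invariant and the
projection is confined to the open sector and the disc `r < r_b` (`curve_mem_osec_of_level`). [folklore] -/
theorem orbit_mem_holeC (hθc : Continuous θ) (h0 : ∀ x, θ (0, x) = x)
    (hHinv : ∀ t x, levelPair (flower g) (θ (t, x)) = levelPair (flower g) x)
    {p : 𝔼 3} (hp : p ∈ holeC hg s) (t : ℝ) : θ (t, p) ∈ holeC hg s := by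
  have hH : ∀ t, levelPair (flower g) (θ (t, p)) = (s, -Real.sqrt (level g - s)) := fun t => by
    rw [hHinv]; exact levelPair_of_mem_holeC hg hp
  have hc : Continuous fun t => proj (θ (t, p)) := proj.continuous.comp (hθc.comp (continuous_id.prodMk continuous_const))
  have hlev : ∀ t, flower g (proj (θ (t, p))) = s := fun t => by
    have h := hH t
    rw [levelPair_apply, Prod.mk.injEq] at h
    exact h.1
  have hconf := curve_mem_osec_of_level hg hc hsb hlev (by simp only [h0]; exact hp.2.2.2.1)
    (by simp only [h0]; exact hp.2.2.2.2) t
  exact mem_holeC_of_levelPair hg hsc (hH t) hconf.1 hconf.2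

/-- **The twist field does not vanish on the hole circle** (cut-off `= 1` and `DH` onto there). [folklore] -/
theorem twistField_ne_zero_of_mem_holeC {B : Set (ℝ × ℝ)}
    (hB : (s, -Real.sqrt (level g - s)) ∈ B)
    (hreg : ∀ x, levelPair (flower g) x ∈ B →
      LinearMap.range (fderiv ℝ (levelPair (flower g)) x : 𝔼 3 →ₗ[ℝ] ℝ × ℝ) = ⊤)
    (hψ1 : ∀ x, levelPair (flower g) x ∈ B → ψ x = 1)
    {x : 𝔼 3} (hx : x ∈ holeC hg s) : twistField bE3 bF2 (levelPair (flower g)) ψ x ≠ 0 := by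
  have hHx : levelPair (flower g) x ∈ B := by rw [levelPair_of_mem_holeC hg hx]; exact hB
  refine twistField_ne_zero ?_ (hreg x hHx)
  rw [hψ1 x hHx]; exact one_ne_zero

include hsb hsc in
/-- **The flow chart at a point of the orbit** (inverse function theorem for
`(t, s') ↦ θ(t, sec s')`): an open neighbourhood in `ℝ³` inside the image of `ℝ × B`.
[cite: LeeSmoothManifolds2013, Thm. 9.22] -/
theorem exists_nhds_flowChart_hole (hθ : ContDiff ℝ ∞ θ) (h0 : ∀ x, θ (0, x) = x)
    (hint : ∀ x t, HasDerivAt (fun t => θ (t, x)) (twistField bE3 bF2 (levelPair (flower g)) ψ (θ (t, x))) t)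
    (hHinv : ∀ t x, levelPair (flower g) (θ (t, x)) = levelPair (flower g) x)
    {B : Set (ℝ × ℝ)} (hBo : IsOpen B) (hB : (s, -Real.sqrt (level g - s)) ∈ B)
    (hreg : ∀ x, levelPair (flower g) x ∈ B →
      LinearMap.range (fderiv ℝ (levelPair (flower g)) x : 𝔼 3 →ₗ[ℝ] ℝ × ℝ) = ⊤)
    (hψ1 : ∀ x, levelPair (flower g) x ∈ B → ψ x = 1)
    {sec : ℝ × ℝ → 𝔼 3} (hσs : ContDiff ℝ ∞ sec) (hHσ : ∀ s' ∈ B, levelPair (flower g) (sec s') = s')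
    (hσ0 : sec (s, -Real.sqrt (level g - s)) ∈ holeC hg s) (u : ℝ) :
    ∃ N : Set (𝔼 3), IsOpen N ∧ θ (u, sec (s, -Real.sqrt (level g - s))) ∈ N ∧
      ∀ w ∈ N, ∃ t : ℝ, ∃ s' ∈ B, θ (t, sec s') = w := by
  set s₀ : ℝ × ℝ := (s, -Real.sqrt (level g - s)) with hs₀
  have hev : ∀ᶠ s' in 𝓝 s₀, levelPair (flower g) (sec s') = s' := by
    filter_upwards [hBo.mem_nhds hB] with s' hs' using hHσ s' hs'
  have hmem := orbit_mem_holeC hg hsb hsc hθ.continuous h0 hHinv hσ0 u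
  have hv0 : twistField bE3 bF2 (levelPair (flower g)) ψ (θ (u, sec s₀)) ≠ 0 :=
    twistField_ne_zero_of_mem_holeC hg hB hreg hψ1 hmem
  obtain ⟨L, hL⟩ := exists_equiv_hasStrictFDerivAt_of_finrank finrank_E3_eq hθ
    (contDiff_levelPair contDiff_flower) hHinv hσs hev u (hint (sec s₀) u) hv0
  have hW : (univ : Set ℝ) ×ˢ B ∈ 𝓝 (u, s₀) := prod_mem_nhds univ_mem (hBo.mem_nhds hB)
  have himg : (fun p : ℝ × (ℝ × ℝ) => θ (p.1, sec p.2)) '' ((univ : Set ℝ) ×ˢ B) ∈ 𝓝 (θ (u, sec s₀)) := by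
    rw [← hL.map_nhds_eq_of_equiv]
    exact image_mem_map hW
  obtain ⟨N, hNsub, hNo, hN⟩ := _root_.mem_nhds_iff.1 himg
  refine ⟨N, hNo, hN, fun w hw => ?_⟩
  obtain ⟨⟨t, s'⟩, ⟨-, hs'⟩, rfl⟩ := hNsub hw
  exact ⟨t, s', hs', rfl⟩

include hsb hsc in
/-- **The orbit of a point of the hole circle with a period is the whole hole circle**: it is
contained in it, closed, relatively open in the level set of `H` (flow chart), and the hole circle
is connected. [folklore] -/
theorem range_orbit_eq_holeC (hθ : ContDiff ℝ ∞ θ) (h0 : ∀ x, θ (0, x) = x)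
    (hadd : ∀ t s x, θ (t, θ (s, x)) = θ (t + s, x))
    (hint : ∀ x t, HasDerivAt (fun t => θ (t, x)) (twistField bE3 bF2 (levelPair (flower g)) ψ (θ (t, x))) t)
    (hHinv : ∀ t x, levelPair (flower g) (θ (t, x)) = levelPair (flower g) x)
    {B : Set (ℝ × ℝ)} (hBo : IsOpen B) (hB : (s, -Real.sqrt (level g - s)) ∈ B)
    (hreg : ∀ x, levelPair (flower g) x ∈ B →
      LinearMap.range (fderiv ℝ (levelPair (flower g)) x : 𝔼 3 →ₗ[ℝ] ℝ × ℝ) = ⊤)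
    (hψ1 : ∀ x, levelPair (flower g) x ∈ B → ψ x = 1)
    {sec : ℝ × ℝ → 𝔼 3} (hσs : ContDiff ℝ ∞ sec) (hHσ : ∀ s' ∈ B, levelPair (flower g) (sec s') = s')
    (hσ0 : sec (s, -Real.sqrt (level g - s)) ∈ holeC hg s)
    (hper : ∃ T : ℝ, 0 < T ∧ θ (T, sec (s, -Real.sqrt (level g - s))) = sec (s, -Real.sqrt (level g - s))) :
    range (fun t => θ (t, sec (s, -Real.sqrt (level g - s)))) = holeC hg s := by
  set m := sec (s, -Real.sqrt (level g - s)) with hm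
  set O : Set (𝔼 3) := range fun t => θ (t, m) with hO
  refine Subset.antisymm (range_subset_iff.2 (orbit_mem_holeC hg hsb hsc hθ.continuous h0 hHinv hσ0)) ?_
  obtain ⟨T, hT, hTm⟩ := hper
  have hOc : IsClosed O := by
    have hOeq : O = (fun t => θ (t, m)) '' Icc 0 T := by
      refine Subset.antisymm ?_ (image_subset_range _ _)
      rintro _ ⟨t, rfl⟩
      obtain ⟨r, hr, hrt⟩ := exists_mem_Ico_apply_eq h0 hadd hT hTm t
      exact ⟨r, Ico_subset_Icc_self hr, hrt.symm⟩
    rw [hOeq]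
    exact (isCompact_Icc.image (hθ.continuous.comp (continuous_id.prodMk continuous_const))).isClosed
  -- relatively open: the union of the flow charts
  choose N hNo hNmem hN using exists_nhds_flowChart_hole hg hsb hsc hθ h0 hint hHinv hBo hB hreg hψ1 hσs hHσ hσ0
  set U : Set (𝔼 3) := ⋃ u, N u with hU
  have hUo : IsOpen U := isOpen_iUnion hNo
  have hOU : O ⊆ U := by rintro _ ⟨u, rfl⟩; exact mem_iUnion.2 ⟨u, hNmem u⟩
  have hUO : ∀ w ∈ U, w ∈ holeC hg s → w ∈ O := by
    intro w hw hwC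
    obtain ⟨u, hu⟩ := mem_iUnion.1 hw
    obtain ⟨t, s', hs', hts⟩ := hN u w hu
    have hs'eq : s' = (s, -Real.sqrt (level g - s)) := by
      rw [← hHσ s' hs', ← hHinv t, hts]; exact levelPair_of_mem_holeC hg hwC
    exact ⟨t, by rw [← hts, hs'eq]⟩
  intro p hp
  by_contra hpO
  have hpre := (isConnected_holeC hg hsb hsc).isPreconnected U Oᶜ hUo hOc.isOpen_compl
    (fun x hx => by by_cases h : x ∈ O; exacts [Or.inl (hOU h), Or.inr h])
    ⟨m, hσ0, hOU ⟨0, h0 m⟩⟩ ⟨p, hp, hpO⟩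
  obtain ⟨w, hwC, hwU, hwO⟩ := hpre
  exact hwO (hUO w hwU hwC)

include hsb hsc in
/-- **The hole orbit package.**  For an `H`-preserving smooth flow of the twist field with a closed
orbit through a point `m` of the hole circle: the orbit passes through the outer axis point
`A⁻ = Cdn(rOut s)`, has a minimal period `T₀ > 0` (the periods of `A⁻` are `ℤ T₀`), and
`u ↦ θ(u T₀, A⁻)` is a simple `1`-periodic parametrisation of the hole circle.
[cite: FarbMargalit2012, §3.1.1] -/
theorem exists_holeOrbit (hθ : ContDiff ℝ ∞ θ) (h0 : ∀ x, θ (0, x) = x)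
    (hadd : ∀ t s x, θ (t, θ (s, x)) = θ (t + s, x))
    (hint : ∀ x t, HasDerivAt (fun t => θ (t, x)) (twistField bE3 bF2 (levelPair (flower g)) ψ (θ (t, x))) t)
    (hHinv : ∀ t x, levelPair (flower g) (θ (t, x)) = levelPair (flower g) x)
    {B : Set (ℝ × ℝ)} (hBo : IsOpen B) (hB : (s, -Real.sqrt (level g - s)) ∈ B)
    (hreg : ∀ x, levelPair (flower g) x ∈ B →
      LinearMap.range (fderiv ℝ (levelPair (flower g)) x : 𝔼 3 →ₗ[ℝ] ℝ × ℝ) = ⊤)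
    (hψ1 : ∀ x, levelPair (flower g) x ∈ B → ψ x = 1)
    {sec : ℝ × ℝ → 𝔼 3} (hσs : ContDiff ℝ ∞ sec) (hHσ : ∀ s' ∈ B, levelPair (flower g) (sec s') = s')
    (hσ0 : sec (s, -Real.sqrt (level g - s)) ∈ holeC hg s)
    (hper : ∃ T : ℝ, 0 < T ∧ θ (T, sec (s, -Real.sqrt (level g - s))) = sec (s, -Real.sqrt (level g - s))) :
    ∃ uA T₀ : ℝ, θ (uA, sec (s, -Real.sqrt (level g - s))) = Cdn g (rOut hg hsb hsc) ∧ 0 < T₀ ∧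
      θ (T₀, sec (s, -Real.sqrt (level g - s))) = sec (s, -Real.sqrt (level g - s)) ∧
      θ (T₀, Cdn g (rOut hg hsb hsc)) = Cdn g (rOut hg hsb hsc) ∧
      (∀ t, θ (t, Cdn g (rOut hg hsb hsc)) = Cdn g (rOut hg hsb hsc) ↔ ∃ n : ℤ, t = n * T₀) ∧
      (∀ u, θ (u * T₀, Cdn g (rOut hg hsb hsc)) ∈ holeC hg s) ∧
      (∀ (u : ℝ) (n : ℤ), θ ((u + n) * T₀, Cdn g (rOut hg hsb hsc)) = θ (u * T₀, Cdn g (rOut hg hsb hsc))) ∧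
      (∀ u v, θ (u * T₀, Cdn g (rOut hg hsb hsc)) = θ (v * T₀, Cdn g (rOut hg hsb hsc)) → ∃ n : ℤ, v = u + n) ∧
      holeC hg s ⊆ range fun u : ℝ => θ (u * T₀, Cdn g (rOut hg hsb hsc)) := by
  set m := sec (s, -Real.sqrt (level g - s)) with hm
  set A := Cdn g (rOut hg hsb hsc) with hA
  have hrange := range_orbit_eq_holeC hg hsb hsc hθ h0 hadd hint hHinv hBo hB hreg hψ1 hσs hHσ hσ0 hper
  obtain ⟨uA, huA⟩ : A ∈ range fun t => θ (t, m) := by rw [hrange]; exact Cdn_rOut_mem_holeC hg hsb hsc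
  obtain ⟨T, hT, hTm⟩ := hper
  -- the orbit moves (it is the whole circle, which has two distinct axis points)
  have hmove : ∃ t, θ (t, m) ≠ m := by
    by_contra h
    push Not at h
    have hsingle : range (fun t => θ (t, m)) = {m} := by
      ext x; simp only [mem_range, mem_singleton_iff]
      exact ⟨fun ⟨t, ht⟩ => ht ▸ h t, fun hx => ⟨0, by rw [h0, hx]⟩⟩
    have h1 : A ∈ ({m} : Set (𝔼 3)) := by rw [← hsingle, hrange]; exact Cdn_rOut_mem_holeC hg hsb hsc
    have h2 : Kup g s (rIn hg hsb hsc) ∈ ({m} : Set (𝔼 3)) := by rw [← hsingle, hrange]; exact Kup_rIn_mem_holeC hg hsb hsc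
    rw [mem_singleton_iff] at h1 h2
    have h3 : ‖proj A‖ = ‖proj (Kup g s (rIn hg hsb hsc))‖ := by rw [h1, h2]
    rw [hA, Cdn, proj_lowerPt, norm_ax, proj_Kup, norm_pol, abs_of_pos (rOut_pos hg hsb hsc),
      abs_of_pos (rIn_pos hg hsb hsc)] at h3
    exact absurd h3 (rIn_lt_rOut hg hsb hsc).ne'
  obtain ⟨T₀, hT₀, hT₀m, hmin⟩ := exists_minimal_period hθ.continuous h0 hadd hT hTm hmove
  -- periods of `A` are the periods of `m`
  have hshift : ∀ t, θ (t, A) = θ (uA, θ (t, m)) := fun t => by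
    rw [← huA, hadd, hadd, add_comm]
  have hinjuA : ∀ x y, θ (uA, x) = θ (uA, y) → x = y := fun x y h => by
    have := congrArg (fun z => θ (-uA, z)) h
    simpa only [hadd, neg_add_cancel, h0] using this
  have hperA : ∀ t, θ (t, A) = A ↔ ∃ n : ℤ, t = n * T₀ := fun t => by
    rw [← hmin t, hshift t]
    conv_lhs => rw [← huA]
    exact ⟨hinjuA _ _, fun h => by rw [h]⟩
  have hAmem : ∀ t, θ (t, A) ∈ holeC hg s := fun t => by
    rw [← huA, hadd]; exact orbit_mem_holeC hg hsb hsc hθ.continuous h0 hHinv hσ0 _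
  have hEper : ∀ (u : ℝ) (n : ℤ), θ ((u + n) * T₀, A) = θ (u * T₀, A) := fun u n => by
    rw [add_mul, ← hadd, (hperA (n * T₀)).2 ⟨n, rfl⟩]
  have hEinj : ∀ u v, θ (u * T₀, A) = θ (v * T₀, A) → ∃ n : ℤ, v = u + n := fun u v h => by
    have h' : θ ((v - u) * T₀, A) = A := by
      have := congrArg (fun z => θ (-(u * T₀), z)) h
      simp only [hadd, neg_add_cancel, h0] at this
      rw [sub_mul, sub_eq_neg_add, ← this]
    obtain ⟨n, hn⟩ := (hperA _).1 h'
    refine ⟨n, ?_⟩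
    have : v - u = n := mul_right_cancel₀ hT₀.ne' hn
    linarith
  have hEsurj : holeC hg s ⊆ range fun u : ℝ => θ (u * T₀, A) := by
    intro q hq
    rw [← hrange] at hq
    obtain ⟨t, rfl⟩ := hq
    refine ⟨(t - uA) / T₀, ?_⟩
    show θ ((t - uA) / T₀ * T₀, A) = θ (t, m)
    rw [div_mul_cancel₀ _ hT₀.ne', ← huA, hadd, sub_add_cancel]
  exact ⟨uA, T₀, huA, hT₀, hT₀m, (hperA T₀).2 ⟨1, by simp⟩, hperA, fun u => hAmem _, hEper, hEinj, hEsurj⟩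

end Flow

/-! ### §6 The end map on points over polar points of the wedge -/

/-- `π/g ≤ π` (`g ≥ 1`). [folklore] -/
theorem pi_div_le_pi (hg : 1 ≤ g) : π / g ≤ π := div_le_self Real.pi_pos.le (by exact_mod_cast hg)

/-- Polar points of the flower domain with `|φ| ≤ π/g` lie in the wedge. [folklore] -/
theorem pol_mem_wedge (hg : 2 ≤ g) {r φ : ℝ} (hr : 0 < r) (hφ : |φ| ≤ π / g) (hq : flower g (pol r φ) ≤ level g) :
    pol r φ ∈ wedge g := by
  have hg1 : 1 ≤ g := by omega
  have h := abs_le.1 (hφ.trans ((pi_div_le_pi_div_two hg).trans (by linarith [Real.pi_pos] : π / 2 ≤ π)))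
  refine ⟨hq, ?_⟩
  rcases h.1.eq_or_lt with h' | h'
  · -- `φ = -π` is impossible for `g ≥ 2`
    exfalso
    have : π ≤ π / g := by rw [← h', abs_neg, abs_of_pos Real.pi_pos] at hφ; exact hφ
    linarith [pi_div_le_pi_div_two hg, Real.pi_pos]
  · rw [arg_toC_pol hr ⟨h', h.2⟩]; exact hφ

/-- **The floor squeeze at time `1` on polar points with `φ ≥ 0`.** [folklore] -/
theorem sqzW_one_pol_of_nonneg (hg : 2 ≤ g) {r φ : ℝ} (hr : 0 < r) (h0 : 0 ≤ φ) (h1 : φ ≤ π / g) :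
    sqzW g 1 (pol r φ) = pol r (thlo g r) := by
  have hg1 : 1 ≤ g := by omega
  have him : 0 ≤ (toC (pol r φ)).im := by
    rw [im_toC_pol]
    exact mul_nonneg hr.le (Real.sin_nonneg_of_nonneg_of_le_pi h0 (h1.trans (pi_div_le_pi hg1)))
  rw [sqzW_of_im_nonneg 1 him, sqz_pol 1 hr (mem_Ioc_of_mem hg1 h0 h1)]
  congr 1; ring

/-- **The floor squeeze at time `1` on polar points with `φ ≤ 0`** (in the wedge). [folklore] -/
theorem sqzW_one_pol_of_nonpos (hg : 2 ≤ g) {r φ : ℝ} (hr : 0 < r) (h0 : φ ≤ 0) (h1 : -(π / g) ≤ φ)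
    (hw : pol r φ ∈ wedge g) : sqzW g 1 (pol r φ) = pol r (-thlo g r) := by
  have hg1 : 1 ≤ g := by omega
  have hπg := pi_div_le_pi hg1
  have him : (toC (pol r φ)).im ≤ 0 := by
    rw [im_toC_pol]
    exact mul_nonpos_of_nonneg_of_nonpos hr.le (Real.sin_nonpos_of_nonpos_of_neg_pi_le h0 (by linarith))
  rw [sqzW_of_im_nonpos hg 1 hw him, refl_pol, sqz_pol 1 hr (mem_Ioc_of_mem hg1 (by linarith) (by linarith)),
    show thlo g r + (1 - 1) * (-φ - thlo g r) = thlo g r by ring, refl_pol]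

/-- **The end map over the `C₁` range** (`7^{1/20g} ≤ r ≤ ρ₃`, lower sheet, strictly inside the
domain): the lower `C₁` point `Cdn r`. [folklore] -/
theorem endMap_lowerPt_pol_mid (hg : 2 ≤ g) {r φ : ℝ} (hr7 : rt g 7 ≤ r) (hr3 : r ≤ rho3 hg) (hφ : |φ| ≤ π / g)
    (hq : flower g (pol r φ) < level g) :
    endMap hg (lowerPt (flower g) (level g) (pol r φ)) = Cdn g r := by
  have hr0 : 0 < r := (rt_pos (by norm_num)).trans_le hr7
  have h2 : lowerPt (flower g) (level g) (pol r φ) 2 < 0 := by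
    rw [lowerPt_apply_two, neg_lt_zero]; exact Real.sqrt_pos.2 (by linarith)
  have hfloor : sqzW g 1 (pol r φ) = ax r := by
    rcases le_total 0 φ with h | h
    · rw [sqzW_one_pol_of_nonneg hg hr0 h (abs_le.1 hφ).2, thlo_eq_zero_of_mem hg hr7 hr3, pol_zero_right]
    · rw [sqzW_one_pol_of_nonpos hg hr0 h (abs_le.1 hφ).1 (pol_mem_wedge hg hr0 hφ hq.le),
        thlo_eq_zero_of_mem hg hr7 hr3, neg_zero, pol_zero_right]
  have hs1 : stage1 g (lowerPt (flower g) (level g) (pol r φ)) = Cdn g r := by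
    rw [stage1, liftMap_of_neg h2, proj_lowerPt, hfloor]; rfl
  have hmem := Cdn_mem_spineZ' hg ⟨hr7, hr3⟩
  rw [endMap, hs1, stage2_eq_self hg hmem.1, whisker_eq_self hg 1 hmem]

/-- The floor points over the lens range lie in the reduced spine (both signs). [folklore] -/
theorem lift_pol_thlo_mem_spineZ'_lens (hg : 2 ≤ g) {r : ℝ} (hr1 : rho1 hg ≤ r) (hr7 : r ≤ rt g 7) :
    lift (pol r (thlo g r)) ∈ spineZ' g hg ∧ lift (pol r (-thlo g r)) ∈ spineZ' g hg := by
  have hr0 : 0 < r := (rho1_pos hg).trans_le hr1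
  have hr4 : r ≤ rho4 hg := hr7.trans (rt_seven_lt_rho4 hg).le
  have hr3 : r ≤ rho3 hg := hr7.trans (rt_seven_lt_rho3 hg).le
  have hseam : flower g (pol r (thlo g r)) = level g :=
    (flower_pol_thlo_eq_level_iff hg hr0 hr4).2 ((level_le_prof_iff hg hr0.le).2 (Or.inl ⟨hr1, hr7⟩))
  have hseam' : flower g (pol r (-thlo g r)) = level g := by rw [flower_pol_neg, hseam]
  refine ⟨⟨⟨lift_mem_flowerSurface hseam, ?_⟩, ?_⟩, ⟨⟨lift_mem_flowerSurface hseam', ?_⟩, ?_⟩⟩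
  · show proj (lift (pol r (thlo g r))) ∈ spineFloor g hg
    rw [proj_lift]; exact Or.inl ⟨r, ⟨hr1, hr4⟩, rfl⟩
  · show ‖proj (lift (pol r (thlo g r)))‖ ≤ rho3 hg
    rw [proj_lift, norm_pol, abs_of_pos hr0]; exact hr3
  · show proj (lift (pol r (-thlo g r))) ∈ spineFloor g hg
    rw [proj_lift]; exact Or.inr ⟨pol r (thlo g r), ⟨r, ⟨hr1, hr4⟩, rfl⟩, refl_pol r _⟩
  · show ‖proj (lift (pol r (-thlo g r)))‖ ≤ rho3 hg
    rw [proj_lift, norm_pol, abs_of_pos hr0]; exact hr3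

/-- **The end map over the lens range, `φ ≥ 0`** (`ρ₁ ≤ r ≤ 7^{1/20g}`, lower sheet): the upper
lens rim point `Lup r`. [folklore] -/
theorem endMap_lowerPt_pol_lens_of_nonneg (hg : 2 ≤ g) {r φ : ℝ} (hr1 : rho1 hg ≤ r) (hr7 : r ≤ rt g 7)
    (h0 : 0 ≤ φ) (hφ : φ ≤ π / g) :
    endMap hg (lowerPt (flower g) (level g) (pol r φ)) = Lup g r := by
  have hr0 : 0 < r := (rho1_pos hg).trans_le hr1
  have hseam : flower g (pol r (thlo g r)) = level g :=
    (flower_pol_thlo_eq_level_iff hg hr0 (hr7.trans (rt_seven_lt_rho4 hg).le)).2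
      ((level_le_prof_iff hg hr0.le).2 (Or.inl ⟨hr1, hr7⟩))
  have hsq : sqzW g 1 (pol r φ) = pol r (thlo g r) := sqzW_one_pol_of_nonneg hg hr0 h0 hφ
  have hs1 : stage1 g (lowerPt (flower g) (level g) (pol r φ)) = lift (pol r (thlo g r)) := by
    rw [stage1, liftMap_of_seam_image (by rw [proj_lowerPt, hsq, hseam]), proj_lowerPt, hsq]
  have hmem := (lift_pol_thlo_mem_spineZ'_lens hg hr1 hr7).1
  rw [endMap, hs1, stage2_eq_self hg hmem.1, whisker_eq_self hg 1 hmem, Lup_of_nonneg hr0.le]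

/-- **The end map over the lens range, `φ ≤ 0`**: the lower lens rim point `Ldn r`. [folklore] -/
theorem endMap_lowerPt_pol_lens_of_nonpos (hg : 2 ≤ g) {r φ : ℝ} (hr1 : rho1 hg ≤ r) (hr7 : r ≤ rt g 7)
    (h0 : φ ≤ 0) (hφ : -(π / g) ≤ φ) (hq : flower g (pol r φ) ≤ level g) :
    endMap hg (lowerPt (flower g) (level g) (pol r φ)) = Ldn g r := by
  have hr0 : 0 < r := (rho1_pos hg).trans_le hr1
  have hseam : flower g (pol r (-thlo g r)) = level g := by
    rw [flower_pol_neg]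
    exact (flower_pol_thlo_eq_level_iff hg hr0 (hr7.trans (rt_seven_lt_rho4 hg).le)).2
      ((level_le_prof_iff hg hr0.le).2 (Or.inl ⟨hr1, hr7⟩))
  have hw : pol r φ ∈ wedge g := pol_mem_wedge hg hr0 (abs_le.2 ⟨hφ, h0.trans (pi_div_pos hg).le⟩) hq
  have hsq : sqzW g 1 (pol r φ) = pol r (-thlo g r) := sqzW_one_pol_of_nonpos hg hr0 h0 hφ hw
  have hs1 : stage1 g (lowerPt (flower g) (level g) (pol r φ)) = lift (pol r (-thlo g r)) := by
    rw [stage1, liftMap_of_seam_image (by rw [proj_lowerPt, hsq, hseam]), proj_lowerPt, hsq]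
  have hmem := (lift_pol_thlo_mem_spineZ'_lens hg hr1 hr7).2
  rw [endMap, hs1, stage2_eq_self hg hmem.1, whisker_eq_self hg 1 hmem, Ldn_of_nonneg hr0.le]

/-- **The end map over the inner range** (`0 < r ≤ ρ₁`, either sheet): the inner pinch point `I`.
[folklore] -/
theorem endMap_of_proj_eq_pol_inner (hg : 2 ≤ g) {p : 𝔼 3} {r φ : ℝ} (hr0 : 0 < r) (hr1 : r ≤ rho1 hg)
    (hφ : |φ| ≤ π / g) (hw : pol r φ ∈ wedge g) (hπ : proj p = pol r φ) : endMap hg p = ptI hg := by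
  have hs1 : proj (stage1 g p) = ax r := by
    rw [stage1, proj_liftMap, hπ]
    rcases le_total 0 φ with h | h
    · rw [sqzW_one_pol_of_nonneg hg hr0 h (abs_le.1 hφ).2, thlo_eq_zero_of_le_rho1 hg hr0.le hr1, pol_zero_right]
    · rw [sqzW_one_pol_of_nonpos hg hr0 h (abs_le.1 hφ).1 hw, thlo_eq_zero_of_le_rho1 hg hr0.le hr1, neg_zero,
        pol_zero_right]
  have hn1 : ‖proj (stage1 g p)‖ ≤ rho1 hg := by rw [hs1, norm_ax, abs_of_pos hr0]; exact hr1
  have hs2 : stage2 hg (stage1 g p) = ptI hg := by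
    rw [stage2, liftMap_of_seam_image (by rw [slide_one_of_le hg hn1, flower_ax_rho1 hg]), slide_one_of_le hg hn1, ptI]
  have hI : ptI hg ∈ spineZ' g hg := by
    refine ⟨⟨lift_mem_flowerSurface (flower_ax_rho1 hg), ?_⟩, ?_⟩
    · show proj (lift (ax (rho1 hg))) ∈ spineFloor g hg
      rw [proj_lift]
      exact Or.inl ⟨rho1 hg, ⟨le_rfl, (rho1_lt_rho4 hg).le⟩, pol_thlo_eq_ax hg (rho1_pos hg).le le_rfl⟩
    · show ‖proj (lift (ax (rho1 hg)))‖ ≤ rho3 hg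
      rw [proj_lift, norm_ax, abs_of_pos (rho1_pos hg)]; exact rho1_le_rho3 hg
  rw [endMap, hs2, whisker_eq_self hg 1 hI]

section EndMapArcs

variable (hg : 2 ≤ g) {s : ℝ} (hsb : prof g (rb hg) < s) (hsc : s < level g)

include hsb hsc in
/-- **The end map on the arcs of the hole circle, outer part** (`r ∈ [7^{1/20g}, rOut s]`): `Cdn r`.
[folklore] -/
theorem endMap_Kup_outer {r : ℝ} (hr7 : rt g 7 ≤ r) (hr : r ≤ rOut hg hsb hsc) : endMap hg (Kup g s r) = Cdn g r := by
  have hg1 : 1 ≤ g := by omega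
  have hr0 : 0 < r := (rt_pos (by norm_num)).trans_le hr7
  have hrb : r ≤ rb hg := hr.trans (rOut_lt_rb hg hsb hsc).le
  have hv := vprof_lt_of_le_rb hg hsb hr0.le hrb
  have hp : s ≤ prof g r := (le_prof_iff hg hsb hsc hr0.le hrb).2 ⟨(rIn_lt_ra hg hsb hsc).le.trans ((ra_lt_rt_seven hg).le.trans hr7), hr⟩
  rw [Kup]
  exact endMap_lowerPt_pol_mid hg hr7 (hr.trans ((rOut_lt_rb hg hsb hsc).le.trans (rho3_mem hg).1.le))
    (by rw [abs_of_nonneg (thloS_nonneg s r)]; exact thloS_le hg1 s r) (by rw [flower_pol_thloS hg1 hr0 hv.le hp]; exact hsc)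

include hsb hsc in
/-- The same for the lower arc. [folklore] -/
theorem endMap_Kdn_outer {r : ℝ} (hr7 : rt g 7 ≤ r) (hr : r ≤ rOut hg hsb hsc) : endMap hg (Kdn g s r) = Cdn g r := by
  have hg1 : 1 ≤ g := by omega
  have hr0 : 0 < r := (rt_pos (by norm_num)).trans_le hr7
  have hrb : r ≤ rb hg := hr.trans (rOut_lt_rb hg hsb hsc).le
  have hv := vprof_lt_of_le_rb hg hsb hr0.le hrb
  have hp : s ≤ prof g r := (le_prof_iff hg hsb hsc hr0.le hrb).2 ⟨(rIn_lt_ra hg hsb hsc).le.trans ((ra_lt_rt_seven hg).le.trans hr7), hr⟩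
  rw [Kdn]
  exact endMap_lowerPt_pol_mid hg hr7 (hr.trans ((rOut_lt_rb hg hsb hsc).le.trans (rho3_mem hg).1.le))
    (by rw [abs_neg, abs_of_nonneg (thloS_nonneg s r)]; exact thloS_le hg1 s r)
    (by rw [flower_pol_neg_thloS hg1 hr0 hv.le hp]; exact hsc)

/-- **The end map on the arcs of the hole circle, lens part** (`r ∈ [ρ₁, 7^{1/20g}]`): the rim
point of the same side, `Lup r` for the upper arc. [folklore] -/
theorem endMap_Kup_lens {r : ℝ} (hr1 : rho1 hg ≤ r) (hr7 : r ≤ rt g 7) : endMap hg (Kup g s r) = Lup g r := by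
  have hg1 : 1 ≤ g := by omega
  rw [Kup]
  exact endMap_lowerPt_pol_lens_of_nonneg hg hr1 hr7 (thloS_nonneg s r) (thloS_le hg1 s r)

include hsb hsc in
/-- The end map on the lower arc over the lens range: `Ldn r`. [folklore] -/
theorem endMap_Kdn_lens {r : ℝ} (hr1 : rho1 hg ≤ r) (hr7 : r ≤ rt g 7) : endMap hg (Kdn g s r) = Ldn g r := by
  have hg1 : 1 ≤ g := by omega
  have hr0 : 0 < r := (rho1_pos hg).trans_le hr1
  have hrb : r ≤ rb hg := hr7.trans (rt_seven_lt_rb hg).le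
  have hv := vprof_lt_of_le_rb hg hsb hr0.le hrb
  rw [Kdn]
  refine endMap_lowerPt_pol_lens_of_nonpos hg hr1 hr7 (by linarith [thloS_nonneg (g := g) s r])
    (by linarith [thloS_le hg1 s r]) ?_
  rw [flower_pol_neg]
  rcases le_or_gt s (prof g r) with hp | hp
  · rw [flower_pol_thloS hg1 hr0 hv.le hp]; exact hsc.le
  · rw [thloS_eq_zero_of_prof_le hg1 hr0 hp.le, pol_zero_right, flower_ax']; exact hp.le.trans hsc.le

include hsb hsc in
/-- **The end map on the arcs of the hole circle, inner part** (`r ∈ [rIn s, ρ₁]`): the pinch point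
`I`. [folklore] -/
theorem endMap_Kup_inner {r : ℝ} (hrI : rIn hg hsb hsc ≤ r) (hr1 : r ≤ rho1 hg) : endMap hg (Kup g s r) = ptI hg := by
  have hg1 : 1 ≤ g := by omega
  have hr0 : 0 < r := (rIn_pos hg hsb hsc).trans_le hrI
  have hφ : |thloS g s r| ≤ π / g := by rw [abs_of_nonneg (thloS_nonneg s r)]; exact thloS_le hg1 s r
  refine endMap_of_proj_eq_pol_inner hg hr0 hr1 hφ (pol_mem_wedge hg hr0 hφ ?_) (proj_Kup s r)
  exact (Kup_mem_flowerSurface hg1 hr0 (vprof_lt_of_le_rb hg hsb hr0.le (hr1.trans ((rho1_mem hg).2.le.trans (ra_lt_rb hg).le))).le hsc.le) |> fun h => by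
    have := apply_proj_le_of_mem h
    rwa [proj_Kup] at this

include hsb hsc in
/-- The same for the lower arc. [folklore] -/
theorem endMap_Kdn_inner {r : ℝ} (hrI : rIn hg hsb hsc ≤ r) (hr1 : r ≤ rho1 hg) : endMap hg (Kdn g s r) = ptI hg := by
  have hg1 : 1 ≤ g := by omega
  have hr0 : 0 < r := (rIn_pos hg hsb hsc).trans_le hrI
  have hφ : |(-thloS g s r)| ≤ π / g := by rw [abs_neg, abs_of_nonneg (thloS_nonneg s r)]; exact thloS_le hg1 s r
  refine endMap_of_proj_eq_pol_inner hg hr0 hr1 hφ (pol_mem_wedge hg hr0 hφ ?_) (proj_Kdn s r)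
  have h := Kdn_mem_flowerSurface hg1 hr0 (vprof_lt_of_le_rb hg hsb hr0.le (hr1.trans ((rho1_mem hg).2.le.trans (ra_lt_rb hg).le))).le hsc.le
  have := apply_proj_le_of_mem h
  rwa [proj_Kdn] at this

end EndMapArcs

/-! ### §7 Reading loops round the hole circle -/

section Loop

variable (hg : 2 ≤ g) {s : ℝ} (hsb : prof g (rb hg) < s) (hsc : s < level g)

/-- The radius clamped to `[rIn s, rOut s]`. [folklore] -/
def clampR (r : ℝ) : ℝ := max (rIn hg hsb hsc) (min r (rOut hg hsb hsc))

/-- Bookkeeping (`clampR_mem`). [folklore] -/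
theorem clampR_mem (r : ℝ) : clampR hg hsb hsc r ∈ Icc (rIn hg hsb hsc) (rOut hg hsb hsc) :=
  ⟨le_max_left _ _, max_le (rIn_lt_rOut hg hsb hsc).le (min_le_right _ _)⟩

/-- Bookkeeping (`clampR_of_mem`). [folklore] -/
theorem clampR_of_mem {r : ℝ} (hr : r ∈ Icc (rIn hg hsb hsc) (rOut hg hsb hsc)) : clampR hg hsb hsc r = r := by
  rw [clampR, min_eq_left hr.2, max_eq_right hr.1]

/-- Bookkeeping (`continuous_clampR`). [folklore] -/
theorem continuous_clampR : Continuous (clampR hg hsb hsc) :=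
  continuous_const.max (continuous_id.min continuous_const)

/-- **The standard parametrisation of the hole circle** by `v ∈ [0, 2]`: the lower arc `Kdn` with
the radius falling from `rOut` to `rIn` on `[0, 1]`, then the upper arc `Kup` with the radius rising
back on `[1, 2]` (clamped outside). [folklore] -/
def Kloop (v : ℝ) : 𝔼 3 :=
  if v ≤ 1 then Kdn g s (clampR hg hsb hsc (rOut hg hsb hsc - (rOut hg hsb hsc - rIn hg hsb hsc) * v))
  else Kup g s (clampR hg hsb hsc (rIn hg hsb hsc + (rOut hg hsb hsc - rIn hg hsb hsc) * (v - 1)))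

/-- Bookkeeping (`Kloop_of_mem_left`). [folklore] -/
theorem Kloop_of_mem_left {v : ℝ} (hv : v ∈ Icc (0:ℝ) 1) :
    Kloop hg hsb hsc v = Kdn g s (rOut hg hsb hsc - (rOut hg hsb hsc - rIn hg hsb hsc) * v) := by
  have hd := rIn_lt_rOut hg hsb hsc
  rw [Kloop, if_pos hv.2, clampR_of_mem hg hsb hsc ⟨by nlinarith [hv.2], by nlinarith [hv.1]⟩]

/-- Bookkeeping (`Kloop_of_mem_right`). [folklore] -/
theorem Kloop_of_mem_right {v : ℝ} (hv : v ∈ Icc (1:ℝ) 2) :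
    Kloop hg hsb hsc v = Kup g s (rIn hg hsb hsc + (rOut hg hsb hsc - rIn hg hsb hsc) * (v - 1)) := by
  have hd := rIn_lt_rOut hg hsb hsc
  rcases hv.1.eq_or_lt with h | h
  · rw [← h, Kloop, if_pos le_rfl, sub_self, mul_zero, add_zero, mul_one, sub_sub_cancel,
      clampR_of_mem hg hsb hsc ⟨le_rfl, hd.le⟩, Kup_rIn_eq_Kdn_rIn hg hsb hsc]
  · rw [Kloop, if_neg (not_le.2 h), clampR_of_mem hg hsb hsc ⟨by nlinarith, by nlinarith [hv.2]⟩]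

/-- Bookkeeping (`continuous_Kloop`). [folklore] -/
theorem continuous_Kloop : Continuous (Kloop hg hsb hsc) := by
  have hg1 : 1 ≤ g := by omega
  have hpos : ∀ r, clampR hg hsb hsc r ∈ Ioi (0:ℝ) := fun r => (rIn_pos hg hsb hsc).trans_le (clampR_mem hg hsb hsc r).1
  have h1 : Continuous fun v : ℝ => Kdn g s (clampR hg hsb hsc (rOut hg hsb hsc - (rOut hg hsb hsc - rIn hg hsb hsc) * v)) :=
    (continuousOn_Kdn hg1 s).comp_continuous ((continuous_clampR hg hsb hsc).comp (by fun_prop)) fun _ => hpos _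
  have h2 : Continuous fun v : ℝ => Kup g s (clampR hg hsb hsc (rIn hg hsb hsc + (rOut hg hsb hsc - rIn hg hsb hsc) * (v - 1))) :=
    (continuousOn_Kup hg1 s).comp_continuous ((continuous_clampR hg hsb hsc).comp (by fun_prop)) fun _ => hpos _
  refine Continuous.if_le h1 h2 continuous_id continuous_const fun v hv => ?_
  rw [hv, mul_one, sub_sub_cancel, sub_self, mul_zero, add_zero,
    clampR_of_mem hg hsb hsc ⟨le_rfl, (rIn_lt_rOut hg hsb hsc).le⟩, Kup_rIn_eq_Kdn_rIn hg hsb hsc]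

/-- Bookkeeping (`Kloop_mem_holeC`). [folklore] -/
theorem Kloop_mem_holeC (v : ℝ) : Kloop hg hsb hsc v ∈ holeC hg s := by
  rw [Kloop]
  split_ifs
  · exact Kdn_mem_holeC hg hsb hsc (clampR_mem hg hsb hsc _)
  · exact Kup_mem_holeC hg hsb hsc (clampR_mem hg hsb hsc _)

/-- Bookkeeping (`Kloop_mem`). [folklore] -/
theorem Kloop_mem (v : ℝ) : Kloop hg hsb hsc v ∈ sectorZ g := holeC_subset_sectorZ hg hsc (Kloop_mem_holeC hg hsb hsc v)

/-- The standard parametrisation as a bundled continuous map. [folklore] -/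
def KloopC : C(ℝ, 𝔼 3) := ⟨Kloop hg hsb hsc, continuous_Kloop hg hsb hsc⟩

/-- Bookkeeping (`KloopC_apply`). [folklore] -/
@[simp] theorem KloopC_apply (v : ℝ) : KloopC hg hsb hsc v = Kloop hg hsb hsc v := rfl

/-- Bookkeeping (`mapsTo_KloopC`). [folklore] -/
theorem mapsTo_KloopC : MapsTo (KloopC hg hsb hsc) univ (sectorZ g) := fun v _ => Kloop_mem hg hsb hsc v

/-- Bookkeeping (`Kloop_zero`). [folklore] -/
theorem Kloop_zero : Kloop hg hsb hsc 0 = Cdn g (rOut hg hsb hsc) := by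
  rw [Kloop_of_mem_left hg hsb hsc ⟨le_rfl, zero_le_one⟩, mul_zero, sub_zero, Kdn_rOut]

/-- Bookkeeping (`Kloop_two`). [folklore] -/
theorem Kloop_two : Kloop hg hsb hsc 2 = Cdn g (rOut hg hsb hsc) := by
  rw [Kloop_of_mem_right hg hsb hsc ⟨by norm_num, le_rfl⟩, show (2:ℝ) - 1 = 1 by norm_num, mul_one,
    add_sub_cancel, Kup_rOut]

/-- Bookkeeping (`Kloop_one`). [folklore] -/
theorem Kloop_one : Kloop hg hsb hsc 1 = Kup g s (rIn hg hsb hsc) := by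
  rw [Kloop_of_mem_right hg hsb hsc ⟨le_rfl, by norm_num⟩, sub_self, mul_zero, add_zero]

/-- **The standard loop once round the hole circle** from the outer axis point `A⁻ = Cdn(rOut s)`:
down the lower arc to the inner axis point and back along the upper arc. [folklore] -/
def stdLoop : Path (Cdn g (rOut hg hsb hsc)) (Cdn g (rOut hg hsb hsc)) :=
  (epath (KloopC hg hsb hsc) 0 2).cast (Kloop_zero hg hsb hsc).symm (Kloop_two hg hsb hsc).symm

/-- Bookkeeping (`stdLoop_mem`). [folklore] -/
theorem stdLoop_mem (t : I) : stdLoop hg hsb hsc t ∈ sectorZ g := by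
  rw [stdLoop, Path.cast_coe]; exact Kloop_mem hg hsb hsc _

/-- The outer axis point differs from the inner one. [folklore] -/
theorem Kup_rIn_ne_Cdn_rOut : Kup g s (rIn hg hsb hsc) ≠ Cdn g (rOut hg hsb hsc) := fun h => by
  have h' := congrArg (fun p => ‖proj p‖) h
  simp only [proj_Kup, norm_pol, Cdn, proj_lowerPt, norm_ax, abs_of_pos (rIn_pos hg hsb hsc),
    abs_of_pos (rOut_pos hg hsb hsc)] at h'
  exact (rIn_lt_rOut hg hsb hsc).ne h'

end Loop

section Runs

variable (hg : 2 ≤ g) {s : ℝ} (hsb : prof g (rb hg) < s) (hsc : s < level g) {E : ℝ → 𝔼 3}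

/-- **The parameter of the inner axis point** of a `1`-periodic parametrisation of the hole circle
from the outer axis point, onto the circle. [folklore] -/
theorem exists_uA (hE0 : E 0 = Cdn g (rOut hg hsb hsc)) (hEper : ∀ (u : ℝ) (n : ℤ), E (u + n) = E u)
    (hEsurj : holeC hg s ⊆ range E) : ∃ uA ∈ Ioo (0 : ℝ) 1, E uA = Kup g s (rIn hg hsb hsc) := by
  obtain ⟨v, hv⟩ := hEsurj (Kup_rIn_mem_holeC hg hsb hsc)
  refine ⟨Int.fract v, ⟨lt_of_le_of_ne (Int.fract_nonneg v) ?_, Int.fract_lt_one v⟩, by rw [apply_fract_eq hEper, hv]⟩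
  intro h0
  have : E (Int.fract v) = Kup g s (rIn hg hsb hsc) := by rw [apply_fract_eq hEper, hv]
  rw [← h0, hE0] at this
  exact Kup_rIn_ne_Cdn_rOut hg hsb hsc this.symm

/-- **The zeros of `y` along one period**: exactly at `0`, `u_A`, `1`. [folklore] -/
theorem apply_one_eq_zero_iff_mem_hole (hE0 : E 0 = Cdn g (rOut hg hsb hsc)) (hEmem : ∀ u, E u ∈ holeC hg s)
    (hEper : ∀ (u : ℝ) (n : ℤ), E (u + n) = E u) (hEinj : ∀ u v, E u = E v → ∃ n : ℤ, v = u + n)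
    {uA : ℝ} (huA : uA ∈ Ioo (0 : ℝ) 1) (hEuA : E uA = Kup g s (rIn hg hsb hsc)) {u : ℝ} (hu : u ∈ Icc (0 : ℝ) 1) :
    E u 1 = 0 ↔ u = 0 ∨ u = uA ∨ u = 1 := by
  have hE1 : E 1 = Cdn g (rOut hg hsb hsc) := by have := hEper 0 1; rw [zero_add, Int.cast_one] at this; rw [this, hE0]
  constructor
  · intro hz
    rcases (apply_one_eq_zero_iff_of_mem_holeC hg hsb hsc (hEmem u)).1 hz with h | h
    · obtain ⟨n, hn⟩ := hEinj uA u (by rw [hEuA, h])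
      have h1 : (-1 : ℝ) < n := by linarith [hu.1, huA.2]
      have h2 : (n : ℝ) < 1 := by linarith [hu.2, huA.1]
      have hn0 : n = 0 := by
        have h1' : (-1 : ℤ) < n := by exact_mod_cast h1
        have h2' : n < (1 : ℤ) := by exact_mod_cast h2
        omega
      right; left; rw [hn, hn0, Int.cast_zero, add_zero]
    · obtain ⟨n, hn⟩ := hEinj 0 u (by rw [hE0, h])
      rw [zero_add] at hn
      have h0n : (0 : ℤ) ≤ n := by have : (0 : ℝ) ≤ n := hn ▸ hu.1; exact_mod_cast this
      have hn1 : n ≤ (1 : ℤ) := by have : (n : ℝ) ≤ 1 := hn ▸ hu.2; exact_mod_cast this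
      rcases (show n = 0 ∨ n = 1 by omega) with rfl | rfl
      · left; rw [hn, Int.cast_zero]
      · right; right; rw [hn, Int.cast_one]
  · rintro (rfl | rfl | rfl)
    · rw [hE0]; exact Cdn_apply_one _
    · rw [hEuA]; exact (apply_one_eq_zero_iff_of_mem_holeC hg hsb hsc (Kup_rIn_mem_holeC hg hsb hsc)).2 (Or.inl rfl)
    · rw [hE1]; exact Cdn_apply_one _

/-- **The two runs of a simple parametrisation of the hole circle** from the outer axis point:
`y ≤ 0` then `y ≥ 0`, or the other way round. [folklore] -/
theorem runs_of_simple_hole (hEc : Continuous E) (hE0 : E 0 = Cdn g (rOut hg hsb hsc))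
    (hEmem : ∀ u, E u ∈ holeC hg s) (hEper : ∀ (u : ℝ) (n : ℤ), E (u + n) = E u)
    (hEinj : ∀ u v, E u = E v → ∃ n : ℤ, v = u + n) (hEsurj : holeC hg s ⊆ range E)
    {uA : ℝ} (huA : uA ∈ Ioo (0 : ℝ) 1) (hEuA : E uA = Kup g s (rIn hg hsb hsc)) :
    ((∀ u ∈ Icc 0 uA, E u 1 ≤ 0) ∧ ∀ u ∈ Icc uA 1, 0 ≤ E u 1) ∨
      ((∀ u ∈ Icc 0 uA, 0 ≤ E u 1) ∧ ∀ u ∈ Icc uA 1, E u 1 ≤ 0) := by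
  have hyc : Continuous fun u => E u 1 := (EuclideanSpace.proj (1 : Fin 3)).continuous.comp hEc
  have hzero := fun u (hu : u ∈ Icc (0 : ℝ) 1) => apply_one_eq_zero_iff_mem_hole hg hsb hsc hE0 hEmem hEper hEinj huA hEuA hu
  have hzL : ∀ w ∈ Ioo 0 uA, E w 1 ≠ 0 := fun w hw h => by
    rcases (hzero w ⟨hw.1.le, hw.2.le.trans huA.2.le⟩).1 h with h' | h' | h' <;>
      [linarith [hw.1]; linarith [hw.2]; linarith [hw.2, huA.2]]
  have hzR : ∀ w ∈ Ioo uA 1, E w 1 ≠ 0 := fun w hw h => by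
    rcases (hzero w ⟨huA.1.le.trans hw.1.le, hw.2.le⟩).1 h with h' | h' | h' <;>
      [linarith [hw.1, huA.1]; linarith [hw.1]; linarith [hw.2]]
  have hL := forall_pos_or_forall_neg hyc huA.1 hzL
  have hR := forall_pos_or_forall_neg hyc huA.2 hzR
  have hy0 : E 0 1 = 0 := by rw [hE0]; exact Cdn_apply_one _
  have hyA : E uA 1 = 0 := (hzero uA ⟨huA.1.le, huA.2.le⟩).2 (Or.inr (Or.inl rfl))
  have hE1 : E 1 = Cdn g (rOut hg hsb hsc) := by have := hEper 0 1; rw [zero_add, Int.cast_one] at this; rw [this, hE0]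
  have hy1 : E 1 1 = 0 := by rw [hE1]; exact Cdn_apply_one _
  have closeL : ∀ {P : ℝ → Prop}, (∀ w ∈ Ioo 0 uA, P (E w 1)) → P 0 → ∀ u ∈ Icc 0 uA, P (E u 1) := by
    intro P hP hP0 u hu
    rcases hu.1.eq_or_lt with h | h
    · rw [← h, hy0]; exact hP0
    rcases hu.2.lt_or_eq with h' | h'
    · exact hP u ⟨h, h'⟩
    · rw [h', hyA]; exact hP0
  have closeR : ∀ {P : ℝ → Prop}, (∀ w ∈ Ioo uA 1, P (E w 1)) → P 0 → ∀ u ∈ Icc uA 1, P (E u 1) := by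
    intro P hP hP0 u hu
    rcases hu.1.eq_or_lt with h | h
    · rw [← h, hyA]; exact hP0
    rcases hu.2.lt_or_eq with h' | h'
    · exact hP u ⟨h, h'⟩
    · rw [h', hy1]; exact hP0
  have hall : ∀ {P : ℝ → Prop}, (∀ u ∈ Icc 0 uA, P (E u 1)) → (∀ u ∈ Icc uA 1, P (E u 1)) → ∀ u, P (E u 1) := by
    intro P h1 h2 u
    rw [← apply_fract_eq hEper u]
    rcases le_total (Int.fract u) uA with h | h
    · exact h1 _ ⟨Int.fract_nonneg u, h⟩
    · exact h2 _ ⟨h, (Int.fract_lt_one u).le⟩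
  -- the witnesses with `y > 0` and `y < 0`
  set rm := (rIn hg hsb hsc + rOut hg hsb hsc) / 2 with hrm
  have hrm1 : rIn hg hsb hsc < rm := by rw [hrm]; linarith [rIn_lt_rOut hg hsb hsc]
  have hrm2 : rm < rOut hg hsb hsc := by rw [hrm]; linarith [rIn_lt_rOut hg hsb hsc]
  rcases hL with hL | hL <;> rcases hR with hR | hR
  · exfalso
    have h := hall (P := fun x => 0 ≤ x) (closeL (P := fun x => 0 ≤ x) (fun w hw => (hL w hw).le) le_rfl)
      (closeR (P := fun x => 0 ≤ x) (fun w hw => (hR w hw).le) le_rfl)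
    obtain ⟨v, hv⟩ := hEsurj (Kdn_mem_holeC hg hsb hsc ⟨hrm1.le, hrm2.le⟩)
    have := h v
    rw [hv] at this
    linarith [Kdn_apply_one_neg hg hsb hsc hrm1 hrm2]
  · exact Or.inr ⟨closeL (P := fun x => 0 ≤ x) (fun w hw => (hL w hw).le) le_rfl,
      closeR (P := fun x => x ≤ 0) (fun w hw => (hR w hw).le) le_rfl⟩
  · exact Or.inl ⟨closeL (P := fun x => x ≤ 0) (fun w hw => (hL w hw).le) le_rfl,
      closeR (P := fun x => 0 ≤ x) (fun w hw => (hR w hw).le) le_rfl⟩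
  · exfalso
    have h := hall (P := fun x => x ≤ 0) (closeL (P := fun x => x ≤ 0) (fun w hw => (hL w hw).le) le_rfl)
      (closeR (P := fun x => x ≤ 0) (fun w hw => (hR w hw).le) le_rfl)
    obtain ⟨v, hv⟩ := hEsurj (Kup_mem_holeC hg hsb hsc ⟨hrm1.le, hrm2.le⟩)
    have := h v
    rw [hv] at this
    linarith [Kup_apply_one_pos hg hsb hsc hrm1 hrm2]

/-- **Reading a simple closed parametrisation of the hole circle.**  Let `E : ℝ → holeC s` be
continuous, `1`-periodic, injective modulo `1`, onto, with `E 0 = A⁻ = Cdn(rOut s)`.  Every loop at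
`A⁻` inside the sector parametrised through `E` over `[0, 1]` from `0` to `1` has the class of the
standard loop `stdLoop` or of its inverse. [cite: HatcherAT2002, Example 1.22] -/
theorem cl_eq_or_of_isParamOn_hole (hEc : Continuous E) (hE0 : E 0 = Cdn g (rOut hg hsb hsc))
    (hEmem : ∀ u, E u ∈ holeC hg s) (hEper : ∀ (u : ℝ) (n : ℤ), E (u + n) = E u)
    (hEinj : ∀ u v, E u = E v → ∃ n : ℤ, v = u + n) (hEsurj : holeC hg s ⊆ range E)
    (p : Path (Cdn g (rOut hg hsb hsc)) (Cdn g (rOut hg hsb hsc))) (hp : ∀ t, p t ∈ sectorZ g)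
    (hpar : IsParamOn E (Icc 0 1) p 0 1) :
    cl p hp = cl (stdLoop hg hsb hsc) (stdLoop_mem hg hsb hsc) ∨
      cl p hp = (cl (stdLoop hg hsb hsc) (stdLoop_mem hg hsb hsc)).symm := by
  obtain ⟨uA, huA, hEuA⟩ := exists_uA hg hsb hsc hE0 hEper hEsurj
  have hE1 : E 1 = Cdn g (rOut hg hsb hsc) := by have := hEper 0 1; rw [zero_add, Int.cast_one] at this; rw [this, hE0]
  set d := rOut hg hsb hsc - rIn hg hsb hsc with hd
  have hd0 : 0 < d := by rw [hd]; linarith [rIn_lt_rOut hg hsb hsc]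
  have hnorm : ∀ u, ‖proj (E u)‖ ∈ Icc (rIn hg hsb hsc) (rOut hg hsb hsc) := fun u => (eq_of_mem_holeC hg hsb hsc (hEmem u)).1
  have hdn : ∀ u, E u 1 ≤ 0 → E u = Kdn g s ‖proj (E u)‖ := fun u h => (eq_of_mem_holeC hg hsb hsc (hEmem u)).2.2 h
  have hup : ∀ u, 0 ≤ E u 1 → E u = Kup g s ‖proj (E u)‖ := fun u h => (eq_of_mem_holeC hg hsb hsc (hEmem u)).2.1 h
  have hn0 : ‖proj (E 0)‖ = rOut hg hsb hsc := by rw [hE0, Cdn, proj_lowerPt, norm_ax, abs_of_pos (rOut_pos hg hsb hsc)]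
  have hn1 : ‖proj (E 1)‖ = rOut hg hsb hsc := by rw [hE1, Cdn, proj_lowerPt, norm_ax, abs_of_pos (rOut_pos hg hsb hsc)]
  have hnA : ‖proj (E uA)‖ = rIn hg hsb hsc := by rw [hEuA, proj_Kup, norm_pol, abs_of_pos (rIn_pos hg hsb hsc)]
  have hnc : Continuous fun u => ‖proj (E u)‖ := continuous_norm.comp (proj.continuous.comp hEc)
  obtain ⟨φ, hφc, hφ0, hφ1, hφJ, hpφ⟩ := hpar
  -- the standard loop, uncast
  have hstd : cl (stdLoop hg hsb hsc) (stdLoop_mem hg hsb hsc) =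
      (cl (epath (KloopC hg hsb hsc) 0 2) (epath_mem convex_univ (mapsTo_KloopC hg hsb hsc) (mem_univ _) (mem_univ _))).cast
        (Subtype.ext (Kloop_zero hg hsb hsc).symm) (Subtype.ext (Kloop_two hg hsb hsc).symm) :=
    cl_cast_split _ _ _ _ _
  rcases runs_of_simple_hole hg hsb hsc hEc hE0 hEmem hEper hEinj hEsurj huA hEuA with ⟨hL, hR⟩ | ⟨hL, hR⟩
  · -- the lower arc first: `p` runs through `Kloop` from `0` to `2`
    left
    set V : ℝ → ℝ := fun u => if u ≤ uA then (rOut hg hsb hsc - ‖proj (E u)‖) / d else 1 + (‖proj (E u)‖ - rIn hg hsb hsc) / d with hV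
    have hVc : Continuous V := by
      refine Continuous.if_le (by fun_prop) (by fun_prop) continuous_id continuous_const fun u hu => ?_
      rw [hu, hnA, hd, sub_self, zero_div, add_zero, div_self hd0.ne']
    have hEV : ∀ u ∈ Icc (0:ℝ) 1, E u = Kloop hg hsb hsc (V u) := by
      intro u hu
      have hr := hnorm u
      by_cases hu' : u ≤ uA
      · have hv : V u = (rOut hg hsb hsc - ‖proj (E u)‖) / d := by rw [hV]; exact if_pos hu'
        have hvm : V u ∈ Icc (0:ℝ) 1 := by
          rw [hv]; exact ⟨div_nonneg (by linarith [hr.2]) hd0.le, (div_le_one hd0).2 (by rw [hd]; linarith [hr.1])⟩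
        rw [Kloop_of_mem_left hg hsb hsc hvm, hdn u (hL u ⟨hu.1, hu'⟩), hv]
        congr 1; field_simp; ring
      · push Not at hu'
        have hv : V u = 1 + (‖proj (E u)‖ - rIn hg hsb hsc) / d := by rw [hV]; exact if_neg (not_le.2 hu')
        have hvm : V u ∈ Icc (1:ℝ) 2 := by
          rw [hv]
          refine ⟨le_add_of_nonneg_right (div_nonneg (by linarith [hr.1]) hd0.le), ?_⟩
          have : (‖proj (E u)‖ - rIn hg hsb hsc) / d ≤ 1 := (div_le_one hd0).2 (by rw [hd]; linarith [hr.2])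
          linarith
        rw [Kloop_of_mem_right hg hsb hsc hvm, hup u (hR u ⟨hu'.le, hu.2⟩), hv]
        congr 1; field_simp; ring
    have hV0 : V 0 = 0 := by
      rw [hV]; simp only [huA.1.le, if_true]; rw [hn0, sub_self, zero_div]
    have hV1 : V 1 = 2 := by
      rw [hV]; simp only [not_le.2 huA.2, if_false]; rw [hn1, hd, div_self hd0.ne']; norm_num
    have hparK : IsParamOn (KloopC hg hsb hsc) univ p 0 2 :=
      isParamOn_of_forall (fun t => V (φ t)) (hVc.comp hφc) (fun _ => mem_univ _)
        (fun t => by rw [hpφ t, KloopC_apply]; exact hEV _ (hφJ t)) (by rw [hφ0, hV0]) (by rw [hφ1, hV1])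
    rw [hstd]
    exact cl_eq_cast_of_isParamOn (KloopC hg hsb hsc) convex_univ (mapsTo_KloopC hg hsb hsc) hp hparK _ _
      (isParamOn_epath _ convex_univ (mem_univ _) (mem_univ _)) (Kloop_zero hg hsb hsc).symm (Kloop_two hg hsb hsc).symm
  · -- the upper arc first: `p` runs through `Kloop` from `2` to `0`
    right
    set V : ℝ → ℝ := fun u => if u ≤ uA then 1 + (‖proj (E u)‖ - rIn hg hsb hsc) / d else (rOut hg hsb hsc - ‖proj (E u)‖) / d with hV
    have hVc : Continuous V := by
      refine Continuous.if_le (by fun_prop) (by fun_prop) continuous_id continuous_const fun u hu => ?_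
      rw [hu, hnA, hd, sub_self, zero_div, add_zero, div_self hd0.ne']
    have hEV : ∀ u ∈ Icc (0:ℝ) 1, E u = Kloop hg hsb hsc (V u) := by
      intro u hu
      have hr := hnorm u
      by_cases hu' : u ≤ uA
      · have hv : V u = 1 + (‖proj (E u)‖ - rIn hg hsb hsc) / d := by rw [hV]; exact if_pos hu'
        have hvm : V u ∈ Icc (1:ℝ) 2 := by
          rw [hv]
          refine ⟨le_add_of_nonneg_right (div_nonneg (by linarith [hr.1]) hd0.le), ?_⟩
          have : (‖proj (E u)‖ - rIn hg hsb hsc) / d ≤ 1 := (div_le_one hd0).2 (by rw [hd]; linarith [hr.2])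
          linarith
        rw [Kloop_of_mem_right hg hsb hsc hvm, hup u (hL u ⟨hu.1, hu'⟩), hv]
        congr 1; field_simp; ring
      · push Not at hu'
        have hv : V u = (rOut hg hsb hsc - ‖proj (E u)‖) / d := by rw [hV]; exact if_neg (not_le.2 hu')
        have hvm : V u ∈ Icc (0:ℝ) 1 := by
          rw [hv]; exact ⟨div_nonneg (by linarith [hr.2]) hd0.le, (div_le_one hd0).2 (by rw [hd]; linarith [hr.1])⟩
        rw [Kloop_of_mem_left hg hsb hsc hvm, hdn u (hR u ⟨hu'.le, hu.2⟩), hv]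
        congr 1; field_simp; ring
    have hV0 : V 0 = 2 := by
      rw [hV]; simp only [huA.1.le, if_true]; rw [hn0, hd, div_self hd0.ne']; norm_num
    have hV1 : V 1 = 0 := by
      rw [hV]; simp only [not_le.2 huA.2, if_false]; rw [hn1, sub_self, zero_div]
    have hparK : IsParamOn (KloopC hg hsb hsc) univ p 2 0 :=
      isParamOn_of_forall (fun t => V (φ t)) (hVc.comp hφc) (fun _ => mem_univ _)
        (fun t => by rw [hpφ t, KloopC_apply]; exact hEV _ (hφJ t)) (by rw [hφ0, hV0]) (by rw [hφ1, hV1])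
    rw [hstd, symm_cast, cl_symm]
    exact cl_eq_cast_of_isParamOn (KloopC hg hsb hsc) convex_univ (mapsTo_KloopC hg hsb hsc) hp hparK _ _
      (isParamOn_epath _ convex_univ (mem_univ _) (mem_univ _)).symm (Kloop_two hg hsb hsc).symm (Kloop_zero hg hsb hsc).symm

end Runs

/-! ### §8 The conjugated standard loop reads `ℓ_b` -/

section ConjReading

variable (hg : 2 ≤ g) {s : ℝ} (hsb : prof g (rb hg) < s) (hsc : s < level g)

include hsb hsc in
/-- Bookkeeping (`rOut_mem_JC`). [folklore] -/
theorem rOut_mem_JC : rOut hg hsb hsc ∈ JC hg :=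
  ⟨(rOut_mem hg hsb hsc).1.le, ((rOut_lt_rb hg hsb hsc).trans (rho3_mem hg).1).le⟩

include hsb hsc in
/-- Bookkeeping (`rIn_lt_rt_seven`). [folklore] -/
theorem rIn_lt_rt_seven : rIn hg hsb hsc < rt g 7 := (rIn_mem hg hsb hsc).2.trans (rho1_lt_rt_seven hg)

/-- **The access path `a₀`** from `P` to the outer axis point `A⁻ = Cdn(rOut s)` along the lower
`C₁` edge. [folklore] -/
def a0P : Path (ptP g) (Cdn g (rOut hg hsb hsc)) where
  toFun t := Cdn g (rt g 7 + (rOut hg hsb hsc - rt g 7) * t)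
  continuous_toFun := (continuous_Cdn g).comp (by fun_prop)
  source' := by simp [Cdn_rt_seven]
  target' := by simp

/-- Bookkeeping (`a0P_apply`). [folklore] -/
theorem a0P_apply (t : I) : a0P hg hsb hsc t = Cdn g (rt g 7 + (rOut hg hsb hsc - rt g 7) * t) := rfl

include hsb hsc in
/-- Bookkeeping (`a0P_radius_mem`). [folklore] -/
theorem a0P_radius_mem (t : I) : rt g 7 + (rOut hg hsb hsc - rt g 7) * t ∈ JC hg :=
  affine_mem (convex_JC hg) (rt_seven_mem_JC hg) (rOut_mem_JC hg hsb hsc) t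

/-- Bookkeeping (`a0P_mem`). [folklore] -/
theorem a0P_mem (t : I) : a0P hg hsb hsc t ∈ sectorZ g := mapsTo_Cdn hg (a0P_radius_mem hg hsb hsc t)

/-- Bookkeeping (`isParamOn_a0P`). [folklore] -/
theorem isParamOn_a0P : IsParamOn (CdnC g) (JC hg) (a0P hg hsb hsc) (rt g 7) (rOut hg hsb hsc) :=
  isParamOn_of_forall (fun t => rt g 7 + (rOut hg hsb hsc - rt g 7) * t) (by fun_prop) (a0P_radius_mem hg hsb hsc)
    (fun _ => rfl) (by simp) (by simp)

/-- **The hole loop at `P`**: out along `a₀`, once round the hole circle (`stdLoop`), back. [folklore] -/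
def holeLoopP : Path (ptP g) (ptP g) :=
  (a0P hg hsb hsc).trans ((stdLoop hg hsb hsc).trans (a0P hg hsb hsc).symm)

/-- Bookkeeping (`holeLoopP_mem`). [folklore] -/
theorem holeLoopP_mem (t : I) : holeLoopP hg hsb hsc t ∈ sectorZ g :=
  VanKampen.trans_mem (a0P_mem hg hsb hsc)
    (VanKampen.trans_mem (stdLoop_mem hg hsb hsc) (VanKampen.symm_mem (a0P_mem hg hsb hsc))) t

/-! #### The end map on the arcs, in terms of the opaque copy -/

include hsb hsc in
/-- Bookkeeping (`endMapI_Kdn_outer`). [folklore] -/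
theorem endMapI_Kdn_outer {r : ℝ} (hr7 : rt g 7 ≤ r) (hr : r ≤ rOut hg hsb hsc) : endMapI hg (Kdn g s r) = Cdn g r := by
  rw [endMapI_def]; exact endMap_Kdn_outer hg hsb hsc hr7 hr

include hsb hsc in
/-- Bookkeeping (`endMapI_Kup_outer`). [folklore] -/
theorem endMapI_Kup_outer {r : ℝ} (hr7 : rt g 7 ≤ r) (hr : r ≤ rOut hg hsb hsc) : endMapI hg (Kup g s r) = Cdn g r := by
  rw [endMapI_def]; exact endMap_Kup_outer hg hsb hsc hr7 hr

include hsb hsc in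
/-- Bookkeeping (`endMapI_Kdn_le`). [folklore] -/
theorem endMapI_Kdn_le {r : ℝ} (hrI : rIn hg hsb hsc ≤ r) (hr7 : r ≤ rt g 7) :
    endMapI hg (Kdn g s r) = Ldn g (max (rho1 hg) r) := by
  rw [endMapI_def]
  rcases le_total (rho1 hg) r with h | h
  · rw [max_eq_right h]; exact endMap_Kdn_lens hg hsb hsc h hr7
  · rw [max_eq_left h, Ldn_rho1]; exact endMap_Kdn_inner hg hsb hsc hrI h

include hsb hsc in
/-- Bookkeeping (`endMapI_Kup_le`). [folklore] -/
theorem endMapI_Kup_le {r : ℝ} (hrI : rIn hg hsb hsc ≤ r) (hr7 : r ≤ rt g 7) :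
    endMapI hg (Kup g s r) = Lup g (max (rho1 hg) r) := by
  rw [endMapI_def]
  rcases le_total (rho1 hg) r with h | h
  · rw [max_eq_right h]; exact endMap_Kup_lens hg h hr7
  · rw [max_eq_left h, Lup_rho1]; exact endMap_Kup_inner hg hsb hsc hrI h

/-! #### The four pieces of the standard loop and their readings -/

/-- The loop parameter at which the falling radius passes `7^{1/20g}`. [folklore] -/
def vSev : ℝ := (rOut hg hsb hsc - rt g 7) / (rOut hg hsb hsc - rIn hg hsb hsc)

/-- The loop parameter at which the rising radius passes `7^{1/20g}`. [folklore] -/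
def wSev : ℝ := 1 + (rt g 7 - rIn hg hsb hsc) / (rOut hg hsb hsc - rIn hg hsb hsc)

/-- Bookkeeping (`vSev_mem`). [folklore] -/
theorem vSev_mem : vSev hg hsb hsc ∈ Icc (0:ℝ) 1 := by
  have h1 := rIn_lt_rt_seven hg hsb hsc
  have h2 := (rOut_mem hg hsb hsc).1
  have hd : 0 < rOut hg hsb hsc - rIn hg hsb hsc := by linarith
  exact ⟨div_nonneg (by linarith) hd.le, (div_le_one hd).2 (by linarith)⟩

/-- Bookkeeping (`wSev_mem`). [folklore] -/
theorem wSev_mem : wSev hg hsb hsc ∈ Icc (1:ℝ) 2 := by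
  have h1 := rIn_lt_rt_seven hg hsb hsc
  have h2 := (rOut_mem hg hsb hsc).1
  have hd : 0 < rOut hg hsb hsc - rIn hg hsb hsc := by linarith
  have h3 : (rt g 7 - rIn hg hsb hsc) / (rOut hg hsb hsc - rIn hg hsb hsc) ≤ 1 := (div_le_one hd).2 (by linarith)
  refine ⟨le_add_of_nonneg_right (div_nonneg (by linarith) hd.le), ?_⟩
  rw [wSev]; linarith

/-- Bookkeeping (`mul_vSev`). [folklore] -/
theorem mul_vSev : (rOut hg hsb hsc - rIn hg hsb hsc) * vSev hg hsb hsc = rOut hg hsb hsc - rt g 7 := by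
  have hd : rOut hg hsb hsc - rIn hg hsb hsc ≠ 0 := (sub_pos.2 (rIn_lt_rOut hg hsb hsc)).ne'
  rw [vSev]; field_simp

/-- Bookkeeping (`mul_wSev_sub_one`). [folklore] -/
theorem mul_wSev_sub_one : (rOut hg hsb hsc - rIn hg hsb hsc) * (wSev hg hsb hsc - 1) = rt g 7 - rIn hg hsb hsc := by
  have hd : rOut hg hsb hsc - rIn hg hsb hsc ≠ 0 := (sub_pos.2 (rIn_lt_rOut hg hsb hsc)).ne'
  rw [wSev]; field_simp; ring

/-- Bookkeeping (`pc_mem`). [folklore] -/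
theorem pc_mem (u v : ℝ) (t : I) : epath (KloopC hg hsb hsc) u v t ∈ sectorZ g :=
  epath_mem convex_univ (mapsTo_KloopC hg hsb hsc) (mem_univ _) (mem_univ _) t

/-- The concatenation of the four pieces. [folklore] -/
def fourP : Path (KloopC hg hsb hsc 0) (KloopC hg hsb hsc 2) :=
  (epath (KloopC hg hsb hsc) 0 (vSev hg hsb hsc)).trans ((epath (KloopC hg hsb hsc) (vSev hg hsb hsc) 1).trans
    ((epath (KloopC hg hsb hsc) 1 (wSev hg hsb hsc)).trans (epath (KloopC hg hsb hsc) (wSev hg hsb hsc) 2)))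

/-- Bookkeeping (`fourP_mem`). [folklore] -/
theorem fourP_mem (t : I) : fourP hg hsb hsc t ∈ sectorZ g :=
  VanKampen.trans_mem (pc_mem hg hsb hsc _ _) (VanKampen.trans_mem (pc_mem hg hsb hsc _ _)
    (VanKampen.trans_mem (pc_mem hg hsb hsc _ _) (pc_mem hg hsb hsc _ _))) t

/-- Bookkeeping (`isParamOn_fourP`). [folklore] -/
theorem isParamOn_fourP : IsParamOn (KloopC hg hsb hsc) univ (fourP hg hsb hsc) 0 2 :=
  (isParamOn_epath _ convex_univ (mem_univ _) (mem_univ _)).trans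
    ((isParamOn_epath _ convex_univ (mem_univ _) (mem_univ _)).trans
      ((isParamOn_epath _ convex_univ (mem_univ _) (mem_univ _)).trans
        (isParamOn_epath _ convex_univ (mem_univ _) (mem_univ _))))

/-- Piece 1 reads the lower `C₁` edge backwards from `rOut` to `7^{1/20g}`. [folklore] -/
theorem isParamOn_emap_pc₁ :
    IsParamOn (CdnC g) (JC hg) (emap hg (epath (KloopC hg hsb hsc) 0 (vSev hg hsb hsc)) (pc_mem hg hsb hsc _ _)) (rOut hg hsb hsc) (rt g 7) := by
  have hv := vSev_mem hg hsb hsc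
  have h7 := (rOut_mem hg hsb hsc).1
  refine isParamOn_of_forall (fun t => rOut hg hsb hsc + (rt g 7 - rOut hg hsb hsc) * t) (by fun_prop)
    (fun t => affine_mem (convex_JC hg) (rOut_mem_JC hg hsb hsc) (rt_seven_mem_JC hg) t) (fun t => ?_)
    (by simp) (by simp)
  have ht1 : vSev hg hsb hsc * t ∈ Icc (0:ℝ) 1 :=
    ⟨mul_nonneg hv.1 t.2.1, (mul_le_one₀ hv.2 t.2.1 t.2.2)⟩
  have hr : rOut hg hsb hsc - (rOut hg hsb hsc - rIn hg hsb hsc) * (vSev hg hsb hsc * t) =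
      rOut hg hsb hsc + (rt g 7 - rOut hg hsb hsc) * t := by
    rw [← mul_assoc, mul_vSev]; ring
  rw [emap_apply, epath_apply, KloopC_apply, zero_add, sub_zero, Kloop_of_mem_left hg hsb hsc ht1, hr, CdnC_apply]
  exact endMapI_Kdn_outer hg hsb hsc (by nlinarith [t.2.2]) (by nlinarith [t.2.1])

/-- Piece 2 reads the lower lens edge backwards from `P` to `I` (the inner part is squeezed to `I`).
[folklore] -/
theorem isParamOn_emap_pc₂ :
    IsParamOn (LdnC hg) (JL hg) (emap hg (epath (KloopC hg hsb hsc) (vSev hg hsb hsc) 1) (pc_mem hg hsb hsc _ _)) (rt g 7) (rho1 hg) := by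
  have hv := vSev_mem hg hsb hsc
  have h7 := (rOut_mem hg hsb hsc).1
  have hI7 := rIn_lt_rt_seven hg hsb hsc
  have hI1 := (rIn_mem hg hsb hsc).2
  have h17 := rho1_lt_rt_seven hg
  set r : I → ℝ := fun t => rOut hg hsb hsc - (rOut hg hsb hsc - rIn hg hsb hsc) * (vSev hg hsb hsc + (1 - vSev hg hsb hsc) * t) with hr
  have hr' : ∀ t : I, r t = rt g 7 + (rIn hg hsb hsc - rt g 7) * t := fun t => by
    have := mul_vSev hg hsb hsc
    rw [hr]; simp only; rw [mul_add, this, ← mul_assoc, mul_sub, mul_one, this]; ring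
  have hrm : ∀ t : I, r t ∈ Icc (rIn hg hsb hsc) (rt g 7) := fun t => by
    rw [hr']; exact ⟨by nlinarith [t.2.2], by nlinarith [t.2.1]⟩
  have hr0 : r 0 = rt g 7 := by rw [hr']; simp
  have hr1 : r 1 = rIn hg hsb hsc := by rw [hr']; simp
  refine isParamOn_of_forall (fun t => max (rho1 hg) (r t)) (continuous_const.max (by rw [hr]; fun_prop))
    (fun t => show max (rho1 hg) (r t) ∈ JL hg from ⟨le_max_left _ _, max_le h17.le (hrm t).2⟩) (fun t => ?_)
    (by rw [hr0, max_eq_right h17.le]) (by rw [hr1, max_eq_left hI1.le])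
  have ht1 : vSev hg hsb hsc + (1 - vSev hg hsb hsc) * t ∈ Icc (0:ℝ) 1 :=
    ⟨by nlinarith [hv.1, hv.2, t.2.1], by nlinarith [hv.2, t.2.2, hv.1]⟩
  rw [emap_apply, epath_apply, KloopC_apply, Kloop_of_mem_left hg hsb hsc ht1, LdnC_apply]
  exact endMapI_Kdn_le hg hsb hsc (hrm t).1 (hrm t).2

/-- Piece 3 reads the upper lens edge from `I` to `P`. [folklore] -/
theorem isParamOn_emap_pc₃ :
    IsParamOn (LupC hg) (JL hg) (emap hg (epath (KloopC hg hsb hsc) 1 (wSev hg hsb hsc)) (pc_mem hg hsb hsc _ _)) (rho1 hg) (rt g 7) := by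
  have hw := wSev_mem hg hsb hsc
  have hI7 := rIn_lt_rt_seven hg hsb hsc
  have hI1 := (rIn_mem hg hsb hsc).2
  have h17 := rho1_lt_rt_seven hg
  set r : I → ℝ := fun t => rIn hg hsb hsc + (rOut hg hsb hsc - rIn hg hsb hsc) * (1 + (wSev hg hsb hsc - 1) * t - 1) with hr
  have hr' : ∀ t : I, r t = rIn hg hsb hsc + (rt g 7 - rIn hg hsb hsc) * t := fun t => by
    have := mul_wSev_sub_one hg hsb hsc
    rw [hr]; simp only; rw [add_sub_cancel_left, ← mul_assoc, this]
  have hrm : ∀ t : I, r t ∈ Icc (rIn hg hsb hsc) (rt g 7) := fun t => by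
    rw [hr']; exact ⟨by nlinarith [t.2.1], by nlinarith [t.2.2]⟩
  have hr0 : r 0 = rIn hg hsb hsc := by rw [hr']; simp
  have hr1 : r 1 = rt g 7 := by rw [hr']; simp
  refine isParamOn_of_forall (fun t => max (rho1 hg) (r t)) (continuous_const.max (by rw [hr]; fun_prop))
    (fun t => show max (rho1 hg) (r t) ∈ JL hg from ⟨le_max_left _ _, max_le h17.le (hrm t).2⟩) (fun t => ?_)
    (by rw [hr0, max_eq_left hI1.le]) (by rw [hr1, max_eq_right h17.le])
  have ht1 : 1 + (wSev hg hsb hsc - 1) * t ∈ Icc (1:ℝ) 2 :=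
    ⟨by nlinarith [hw.1, t.2.1], by nlinarith [hw.2, t.2.2, hw.1]⟩
  rw [emap_apply, epath_apply, KloopC_apply, Kloop_of_mem_right hg hsb hsc ht1, LupC_apply]
  exact endMapI_Kup_le hg hsb hsc (hrm t).1 (hrm t).2

/-- Piece 4 reads the lower `C₁` edge from `7^{1/20g}` to `rOut`. [folklore] -/
theorem isParamOn_emap_pc₄ :
    IsParamOn (CdnC g) (JC hg) (emap hg (epath (KloopC hg hsb hsc) (wSev hg hsb hsc) 2) (pc_mem hg hsb hsc _ _)) (rt g 7) (rOut hg hsb hsc) := by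
  have hw := wSev_mem hg hsb hsc
  have h7 := (rOut_mem hg hsb hsc).1
  have hI7 := rIn_lt_rt_seven hg hsb hsc
  set r : I → ℝ := fun t => rIn hg hsb hsc + (rOut hg hsb hsc - rIn hg hsb hsc) * (wSev hg hsb hsc + (2 - wSev hg hsb hsc) * t - 1) with hr
  have hr' : ∀ t : I, r t = rt g 7 + (rOut hg hsb hsc - rt g 7) * t := fun t => by
    have := mul_wSev_sub_one hg hsb hsc
    rw [hr]; simp only
    have e : wSev hg hsb hsc + (2 - wSev hg hsb hsc) * t - 1 = (wSev hg hsb hsc - 1) * (1 - t) + t := by ring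
    rw [e, mul_add, ← mul_assoc, this]; ring
  have hrm : ∀ t : I, r t ∈ Icc (rt g 7) (rOut hg hsb hsc) := fun t => by
    rw [hr']; exact ⟨by nlinarith [t.2.1], by nlinarith [t.2.2]⟩
  refine isParamOn_of_forall r (by rw [hr]; fun_prop)
    (fun t => show r t ∈ JC hg from ⟨(hrm t).1, (hrm t).2.trans (rOut_mem_JC hg hsb hsc).2⟩) (fun t => ?_)
    (by rw [hr']; simp) (by rw [hr']; simp)
  have ht1 : wSev hg hsb hsc + (2 - wSev hg hsb hsc) * t ∈ Icc (1:ℝ) 2 :=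
    ⟨by nlinarith [hw.1, hw.2, t.2.1], by nlinarith [hw.2, t.2.2, hw.1]⟩
  rw [emap_apply, epath_apply, KloopC_apply, Kloop_of_mem_right hg hsb hsc ht1, CdnC_apply]
  exact endMapI_Kup_outer hg hsb hsc (hrm t).1 (hrm t).2

/-- The access path is fixed by the end map: it reads the lower `C₁` edge from `7^{1/20g}` to
`rOut`. [folklore] -/
theorem isParamOn_emap_a0P :
    IsParamOn (CdnC g) (JC hg) (emap hg (a0P hg hsb hsc) (a0P_mem hg hsb hsc)) (rt g 7) (rOut hg hsb hsc) := by
  refine isParamOn_of_forall (fun t => rt g 7 + (rOut hg hsb hsc - rt g 7) * t) (by fun_prop)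
    (fun t => affine_mem (convex_JC hg) (rt_seven_mem_JC hg) (rOut_mem_JC hg hsb hsc) t) (fun t => ?_) (by simp) (by simp)
  rw [emap_apply, a0P_apply, CdnC_apply]
  exact endMapI_eq_self hg (Cdn_mem_spineZ' hg (affine_mem (convex_JC hg) (rt_seven_mem_JC hg) (rOut_mem_JC hg hsb hsc) t))

/-- The four-piece loop, cast to the outer axis point. [folklore] -/
theorem fourP_cast_mem (t : I) :
    (fourP hg hsb hsc).cast (Kloop_zero hg hsb hsc).symm (Kloop_two hg hsb hsc).symm t ∈ sectorZ g := by
  rw [Path.cast_coe]; exact fourP_mem hg hsb hsc t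

/-- The hole loop with the standard loop replaced by its four pieces. [folklore] -/
def loop4P : Path (ptP g) (ptP g) :=
  (a0P hg hsb hsc).trans ((((fourP hg hsb hsc).cast (Kloop_zero hg hsb hsc).symm (Kloop_two hg hsb hsc).symm)).trans
    (a0P hg hsb hsc).symm)

/-- Bookkeeping (`loop4P_mem`). [folklore] -/
theorem loop4P_mem : ∀ t, loop4P hg hsb hsc t ∈ sectorZ g :=
  VanKampen.trans_mem (a0P_mem hg hsb hsc)
    (VanKampen.trans_mem (fourP_cast_mem hg hsb hsc) (VanKampen.symm_mem (a0P_mem hg hsb hsc)))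

/-- Step 1: the hole loop and the four-piece loop have the same class. [folklore] -/
theorem cl_holeLoopP_eq_loop4P :
    cl (holeLoopP hg hsb hsc) (holeLoopP_mem hg hsb hsc) = cl (loop4P hg hsb hsc) (loop4P_mem hg hsb hsc) := by
  have h1 : cl (stdLoop hg hsb hsc) (stdLoop_mem hg hsb hsc) =
      (cl (epath (KloopC hg hsb hsc) 0 2) (pc_mem hg hsb hsc 0 2)).cast
        (Subtype.ext (Kloop_zero hg hsb hsc).symm) (Subtype.ext (Kloop_two hg hsb hsc).symm) :=
    cl_cast_split _ _ _ _ _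
  have h2 : cl ((fourP hg hsb hsc).cast (Kloop_zero hg hsb hsc).symm (Kloop_two hg hsb hsc).symm) (fourP_cast_mem hg hsb hsc) =
      (cl (fourP hg hsb hsc) (fourP_mem hg hsb hsc)).cast
        (Subtype.ext (Kloop_zero hg hsb hsc).symm) (Subtype.ext (Kloop_two hg hsb hsc).symm) :=
    cl_cast_split _ _ _ _ _
  have h3 : cl (epath (KloopC hg hsb hsc) 0 2) (pc_mem hg hsb hsc 0 2) = cl (fourP hg hsb hsc) (fourP_mem hg hsb hsc) := by
    rw [cl_eq_cast_of_isParamOn (KloopC hg hsb hsc) convex_univ (mapsTo_KloopC hg hsb hsc) (pc_mem hg hsb hsc 0 2)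
      (isParamOn_epath _ convex_univ (mem_univ _) (mem_univ _)) _ (fourP_mem hg hsb hsc) (isParamOn_fourP hg hsb hsc) rfl rfl,
      cast_eq_self]
  change cl ((a0P hg hsb hsc).trans ((stdLoop hg hsb hsc).trans (a0P hg hsb hsc).symm)) _ =
    cl ((a0P hg hsb hsc).trans ((((fourP hg hsb hsc).cast (Kloop_zero hg hsb hsc).symm (Kloop_two hg hsb hsc).symm)).trans
      (a0P hg hsb hsc).symm)) _
  rw [cl_trans_split, cl_trans_split, cl_symm_split, cl_trans_split, cl_trans_split, cl_symm_split, h1, h2, h3]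

/-- **The hole loop at `P` reads `ℓ_b = y⁻¹ x`** in the homotopy quotient of the sector: read
through the end map (`fromPath_cl_eq_emap`), the access stubs cancel, the lower arc reads `y⁻¹`
and the upper arc reads `x`. [cite: HatcherAT2002, Prop. 1.17] [cite: ZieschangVogtColdewey1980, §3.2] -/
theorem cl_holeLoopP :
    cl (holeLoopP hg hsb hsc) (holeLoopP_mem hg hsb hsc) = cl (loopR hg (0, true)) (loopR_mem_sectorZ hg (0, true)) := by
  have hK0 := Kloop_zero hg hsb hsc
  have hK2 := Kloop_two hg hsb hsc
  -- Step 2: read the four-piece loop through the end map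
  have hread := fromPath_cl_eq_emap hg (loop4P hg hsb hsc) (loop4P_mem hg hsb hsc)
  change cl (loop4P hg hsb hsc) (loop4P_mem hg hsb hsc) =
    cl ((emap hg (loop4P hg hsb hsc) (loop4P_mem hg hsb hsc)).cast (endMap_ptP hg).symm (endMap_ptP hg).symm) _ at hread
  -- the end point values
  have eP : endMapI hg (ptP g) = ptP g := endMap_ptP hg
  have eA : endMapI hg (Cdn g (rOut hg hsb hsc)) = Cdn g (rOut hg hsb hsc) :=
    endMapI_eq_self hg (Cdn_mem_spineZ' hg (rOut_mem_JC hg hsb hsc))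
  have e0 : endMapI hg (KloopC hg hsb hsc 0) = Cdn g (rOut hg hsb hsc) := by
    rw [(isParamOn_emap_pc₁ hg hsb hsc).source_eq, CdnC_apply]
  have eV : endMapI hg (KloopC hg hsb hsc (vSev hg hsb hsc)) = ptP g := by
    rw [(isParamOn_emap_pc₁ hg hsb hsc).target_eq, CdnC_apply, Cdn_rt_seven]
  have e1 : endMapI hg (KloopC hg hsb hsc 1) = ptI hg := by
    rw [(isParamOn_emap_pc₂ hg hsb hsc).target_eq, LdnC_apply, Ldn_rho1]
  have eW : endMapI hg (KloopC hg hsb hsc (wSev hg hsb hsc)) = ptP g := by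
    rw [(isParamOn_emap_pc₄ hg hsb hsc).source_eq, CdnC_apply, Cdn_rt_seven]
  have e2 : endMapI hg (KloopC hg hsb hsc 2) = Cdn g (rOut hg hsb hsc) := by
    rw [(isParamOn_emap_pc₄ hg hsb hsc).target_eq, CdnC_apply]
  -- the five readings
  have rA : cl (emap hg (a0P hg hsb hsc) (a0P_mem hg hsb hsc)) (emap_mem hg _ _) =
      (cl (a0P hg hsb hsc) (a0P_mem hg hsb hsc)).cast (Subtype.ext eP) (Subtype.ext eA) :=
    cl_eq_cast_of_isParamOn (CdnC g) (convex_JC hg) (mapsTo_Cdn hg) _ (isParamOn_emap_a0P hg hsb hsc) _ _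
      (isParamOn_a0P hg hsb hsc) eP eA
  have r1 : cl (emap hg (epath (KloopC hg hsb hsc) 0 (vSev hg hsb hsc)) (pc_mem hg hsb hsc _ _)) (emap_mem hg _ _) =
      (cl (a0P hg hsb hsc) (a0P_mem hg hsb hsc)).symm.cast (Subtype.ext e0) (Subtype.ext eV) := by
    rw [cl_symm]
    exact cl_eq_cast_of_isParamOn (CdnC g) (convex_JC hg) (mapsTo_Cdn hg) _ (isParamOn_emap_pc₁ hg hsb hsc) _ _
      (isParamOn_a0P hg hsb hsc).symm e0 eV
  have r2 : cl (emap hg (epath (KloopC hg hsb hsc) (vSev hg hsb hsc) 1) (pc_mem hg hsb hsc _ _)) (emap_mem hg _ _) =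
      (atomY hg).symm.cast (Subtype.ext eV) (Subtype.ext e1) :=
    cl_eq_atomY_symm hg _ (isParamOn_emap_pc₂ hg hsb hsc) eV e1
  have r3 : cl (emap hg (epath (KloopC hg hsb hsc) 1 (wSev hg hsb hsc)) (pc_mem hg hsb hsc _ _)) (emap_mem hg _ _) =
      (atomX hg).cast (Subtype.ext e1) (Subtype.ext eW) :=
    cl_eq_atomX hg _ (isParamOn_emap_pc₃ hg hsb hsc) e1 eW
  have r4 : cl (emap hg (epath (KloopC hg hsb hsc) (wSev hg hsb hsc) 2) (pc_mem hg hsb hsc _ _)) (emap_mem hg _ _) =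
      (cl (a0P hg hsb hsc) (a0P_mem hg hsb hsc)).cast (Subtype.ext eW) (Subtype.ext e2) :=
    cl_eq_cast_of_isParamOn (CdnC g) (convex_JC hg) (mapsTo_Cdn hg) _ (isParamOn_emap_pc₄ hg hsb hsc) _ _
      (isParamOn_a0P hg hsb hsc) eW e2
  -- Step 3: assemble
  rw [cl_holeLoopP_eq_loop4P, hread, cl_cast_split _ (emap_mem hg _ _)]
  change (cl (emap hg ((a0P hg hsb hsc).trans ((((fourP hg hsb hsc).cast hK0.symm hK2.symm)).trans (a0P hg hsb hsc).symm))
    (VanKampen.trans_mem (a0P_mem hg hsb hsc)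
      (VanKampen.trans_mem (fourP_cast_mem hg hsb hsc) (VanKampen.symm_mem (a0P_mem hg hsb hsc))))) _).cast _ _ = _
  rw [cl_emap_trans hg _ _ (a0P_mem hg hsb hsc)
      (VanKampen.trans_mem (fourP_cast_mem hg hsb hsc) (VanKampen.symm_mem (a0P_mem hg hsb hsc))),
    cl_emap_trans hg _ _ (fourP_cast_mem hg hsb hsc) (VanKampen.symm_mem (a0P_mem hg hsb hsc)),
    cl_emap_symm hg _ (a0P_mem hg hsb hsc), cl_emap_cast hg _ (fourP_mem hg hsb hsc)]
  change (((cl (emap hg (a0P hg hsb hsc) (a0P_mem hg hsb hsc)) _).trans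
    (((cl (emap hg ((epath (KloopC hg hsb hsc) 0 (vSev hg hsb hsc)).trans ((epath (KloopC hg hsb hsc) (vSev hg hsb hsc) 1).trans
      ((epath (KloopC hg hsb hsc) 1 (wSev hg hsb hsc)).trans (epath (KloopC hg hsb hsc) (wSev hg hsb hsc) 2))))
      (VanKampen.trans_mem (pc_mem hg hsb hsc _ _) (VanKampen.trans_mem (pc_mem hg hsb hsc _ _)
        (VanKampen.trans_mem (pc_mem hg hsb hsc _ _) (pc_mem hg hsb hsc _ _))))) _).cast _ _).trans
      (cl (emap hg (a0P hg hsb hsc) (a0P_mem hg hsb hsc)) _).symm)).cast _ _) = _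
  rw [cl_emap_trans hg _ _ (pc_mem hg hsb hsc _ _) (VanKampen.trans_mem (pc_mem hg hsb hsc _ _)
      (VanKampen.trans_mem (pc_mem hg hsb hsc _ _) (pc_mem hg hsb hsc _ _))),
    cl_emap_trans hg _ _ (pc_mem hg hsb hsc _ _) (VanKampen.trans_mem (pc_mem hg hsb hsc _ _) (pc_mem hg hsb hsc _ _)),
    cl_emap_trans hg _ _ (pc_mem hg hsb hsc _ _) (pc_mem hg hsb hsc _ _), rA, r1, r2, r3, r4, cl_loopR_b]
  simp only [symm_cast, cast_trans_cast, Path.Homotopic.Quotient.cast_cast, cast_eq_self,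
    Path.Homotopic.Quotient.trans_assoc, Path.Homotopic.Quotient.trans_symm, Path.Homotopic.Quotient.trans_refl]
  rw [← Path.Homotopic.Quotient.trans_assoc, Path.Homotopic.Quotient.trans_symm, Path.Homotopic.Quotient.refl_trans]

end ConjReading

end FlowerModel

end Literature.Topology.FourManifolds

end
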